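import Literature.Probability.LatticeModels.NVectorInfraredBoundProofs
import HarnessLib

/-!
# Gaussian domination and the infrared bound for `ν`-vector models with DIRECTION-DEPENDENT nearest-neighbour couplings on the torus (Fröhlich–Israel–Lieb–Simon 1978, §3 (C) and Thms. 4.6–4.7)

Topic `Probability/LatticeModels`; companion of `NVectorInfraredBound.lean` /
`NVectorInfraredBoundProofs.lean` (Fröhlich–Simon–Spencer 1976 via Friedli–Velenik 2017, Thm. 10.24:
the ISOTROPIC nearest-neighbour `ν`-vector model on `(ℤ/Lℤ)^d`). Here the same printed argument is
run for the Hamiltonian with one coupling constant per lattice direction,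
`ℋ_{β,K}(ω) = β ∑_x ∑_i K_i ‖ω(x + eᵢ) − ω(x)‖²` (`K_i ≥ 0`; the layered model of the
interlayer-coupling literature is `d = 3`, `K = (J∥, J∥, J⊥)`), which is reflection positive for
every reflection through planes bisecting bonds: Fröhlich–Israel–Lieb–Simon, *Phase transitions and
reflection positivity. I*, Comm. Math. Phys. 62 (1978) 1–34, §3 (C), eq. (3.6) — reflection
positivity through the plane `x₁ = ½` only involves the couplings `J(i₁, ·)` with `i₁ ≥ 1`, for
nearest neighbours the single nonnegative number `K₁` — and Thms. 4.6–4.7: Gaussian domination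
`Z(h) ≤ Z(0)` and the infrared bound `g(p) ≤ (2βE_p)⁻¹` "with `E_p` depending on `J`", here the
anisotropic dispersion `E_p = ε_K(p) = ∑_i K_i(1 − cos p_i)` (for the quantum antiferromagnet
interpolating between two and three dimensions this is Kennedy–Lieb–Shastry 1988 eq. (7),
`E^r_q = 2 − cos q₁ − cos q₂ + r(1 − cos q₃)`).

The proof is Friedli–Velenik's (§10.5.3, pp. 503–507) with a weight per edge. Everything generic is
done for a finite graph `G` with an EDGE WEIGHT `w : Sym2 V → ℝ`, `w ≥ 0`, invariant under the
reflection (`w(θe) = w(e)` on edges): the weighted bond form `𝓔_w(f,g) = ∑_{e={x,y}} w_e (f_x − f_y)·(g_x − g_y)`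
(`vecGradFormW`), the functional `Z_w(h) = ∫ e^{−β𝓔_w(ω+h, ω+h)} dμ₀` (`vZW`), its two-half form along a
reflection (`halfExpW`, `pairKernelW`, `exponent_split`: the crossing term is
`2β ∑_{x crossing} w_{x,θx} (ω_x + h_x)·(ω_{θx} + h_{θx})`, the same weight on both factors, so
Lemma 10.28 applies with the features `√w_{x,θx}(τ_x^a + h_x^a)` — `pairIntW_sq_le`), hence
`Z_w(h)² ≤ Z_w(h⁺)Z_w(h⁻)` (`vZW_sq_le_reflect`). On the torus the direction weight
`dirWeight K {x, x ± eᵢ} = K_i` is invariant under every reflection between sites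
(`dirWeight_map_reflectBetweenSites`: a bond keeps its direction), so the printed descent on the number
of bad bonds gives **Gaussian domination** `Z_{β,K}(h) ≤ Z_{β,K}(0)` (`vZW_le_vZW_zero`); the
second-order expansion (10.46)–(10.47) (`integral_weight_vecGradFormW_sq_le`) and the plane waves
`h_x = e^{ip·x}e_a`, for which `𝓔_w(ω, h) = 2ε_K(p) Ŝ^a(p)` and `𝓔_w(h,h) = 2|𝕋_L|ε_K(p)`
(`gradFormCW_torusChar_fun`, `gradNormSqW_torusChar`), give the **anisotropic infrared bound** and, for
unit spins, the finite-volume long-range-order bound (Plancherel (10.39)–(10.40), reused from the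
isotropic file):

* `NVectorAniso.aniso_infraredBound`: for `L` even, `L ≥ 4`, `β > 0`, `K_i > 0`, a nonzero finite
  compactly supported single-spin law `ρ`, and every `k ≠ 0`,
  `|𝕋_L|⁻¹ ⟨‖∑_x e^{−ip·x}S_x‖²⟩_{β,K} ≤ ν / (4β ε_K(p))`, `p = 2πk/L`;
* `NVectorAniso.aniso_longRangeOrderBound`: if moreover `‖S‖ = 1` a.s.,
  `⟨‖m_L‖²⟩_{β,K} ≥ 1 − (ν/4β)|𝕋_L|⁻¹∑_{k≠0} ε_K(2πk/L)⁻¹`.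

For `K ≡ 1` these are the two clauses of `FriedliVelenik2017_nVector_infraredBound` (the tree's
isotropic theorem; `anisoGibbs_one`, `anisoDispersion_one` identify the objects); for `K = (J∥, J∥, J⊥)` the torus sum is Kennedy–Lieb–Shastry's
`|Λ|⁻¹∑_{q≠0} 1/E^r_q`, `r = J⊥/J∥`, whose small-`r` growth is only logarithmic in `d = 3` — the
interlayer ordering floor with the Hikami–Tsuneto logarithm (packaged for the plane rotator in a
sibling file). All results PROVED; the definitions are the weighted copies of the isotropic ones.
NOT here: the thermodynamic limit of the anisotropic torus sums; quantum models.

## References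

* J. Fröhlich, R. Israel, E. H. Lieb, B. Simon, *Phase transitions and reflection positivity. I.
  General theory and long range lattice models*, Comm. Math. Phys. 62 (1978) 1–34, §3 (C) eq. (3.6),
  pp. 12–13 and Thms. 4.6–4.7 with (4.6)–(4.10), pp. 25–27 (read in E. H. Lieb, *Statistical Mechanics. Selecta*,
  Springer) [FILS1978].
* S. Friedli, Y. Velenik, *Statistical Mechanics of Lattice Systems*, CUP (2017), §10.5.3,
  Prop. 10.27, Lemma 10.28, Thm. 10.24, (10.39)–(10.47) [FriedliVelenik2017].
* J. Fröhlich, B. Simon, T. Spencer, Comm. Math. Phys. 50 (1976) 79–95 [FrohlichSimonSpencer1976].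
* T. Kennedy, E. H. Lieb, B. S. Shastry, J. Stat. Phys. 53 (1988) 1019–1030, eqs. (5)–(7)
  [KLS1988JSP].
-/

noncomputable section

open MeasureTheory Filter Topology Finset
open scoped Real

namespace Literature.Probability.LatticeModels

namespace NVectorAniso

open NVector

/-! ### The weighted bond form and the functional `Z_w(h)` -/

section VectorForms

variable {V : Type*} [Fintype V] (G : SimpleGraph V) [DecidableRel G.Adj] {ν : ℕ}

/-- The **weighted bond form** of `ν`-component fields,
`𝓔_w(f,g) = ∑_{e = {x,y} ∈ E} w_e (f_x − f_y)·(g_x − g_y)` for an edge weight `w` — the quadratic form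
of the Hamiltonian `½∑ J_{αγ}(σ_α − σ_γ)²` of Fröhlich–Israel–Lieb–Simon's Thm. 4.6 with couplings
supported on the edges of `G`. [cite: FILS1978, Thm. 4.6 (the Hamiltonian H)] -/
def vecGradFormW (w : Sym2 V → ℝ) (f g : V → Fin ν → ℝ) : ℝ :=
  ∑ e ∈ G.edgeFinset, w e * Sym2.lift ⟨fun x y => ∑ a, (f x a - f y a) * (g x a - g y a),
    fun x y => Finset.sum_congr rfl fun a _ => by ring⟩ e

/-- The **weighted scalar bond form** `∑_{e={x,y}} w_e (f_x − f_y)(g_x − g_y)` (one component).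
[cite: FILS1978, Thm. 4.6 (the Hamiltonian H)] -/
def gradFormW (w : Sym2 V → ℝ) (f g : V → ℝ) : ℝ :=
  ∑ e ∈ G.edgeFinset, w e * Sym2.lift ⟨fun x y => (f x - f y) * (g x - g y), fun x y => by ring⟩ e

/-- The complexified weighted bond form `∑_{e={x,y}} w_e (f_x − f_y)(g_x − g_y)`, `f` real, `g`
complex (the plane waves of the proof of Thm. 10.24). [cite: FriedliVelenik2017, §10.5.3, proof of Thm. 10.24] -/
def gradFormCW (w : Sym2 V → ℝ) (f : V → ℝ) (g : V → ℂ) : ℂ :=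
  ∑ e ∈ G.edgeFinset, (w e : ℂ) * Sym2.lift ⟨fun x y => ((f x - f y : ℝ) : ℂ) * (g x - g y),
    fun x y => by push_cast; ring⟩ e

/-- The weighted squared bond norm `∑_{e={x,y}} w_e ‖g_x − g_y‖²` of a complex function.
[cite: FriedliVelenik2017, §10.5.3, proof of Thm. 10.24] -/
def gradNormSqW (w : Sym2 V → ℝ) (g : V → ℂ) : ℝ :=
  ∑ e ∈ G.edgeFinset, w e * Sym2.lift ⟨fun x y => ‖g x - g y‖ ^ 2, fun x y => by
    show ‖g x - g y‖ ^ 2 = ‖g y - g x‖ ^ 2; rw [norm_sub_rev]⟩ e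

variable {G}

/-- Expansion of the weighted vector quadratic form along a line:
`𝓔_w(s + t h) = 𝓔_w(s) + 2t 𝓔_w(s,h) + t² 𝓔_w(h)`. [folklore] -/
private theorem vecGradFormW_add_smul_self (w : Sym2 V → ℝ) (s h : V → Fin ν → ℝ) (t : ℝ) :
    vecGradFormW G w (s + t • h) (s + t • h) =
      vecGradFormW G w s s + 2 * t * vecGradFormW G w s h + t ^ 2 * vecGradFormW G w h h := by
  unfold vecGradFormW
  rw [Finset.mul_sum, Finset.mul_sum, ← Finset.sum_add_distrib, ← Finset.sum_add_distrib]
  refine Finset.sum_congr rfl fun e _ => ?_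
  induction e using Sym2.ind with
  | _ x y =>
    simp only [Sym2.lift_mk, Pi.add_apply, Pi.smul_apply, smul_eq_mul, Finset.mul_sum,
      ← Finset.sum_add_distrib]
    exact Finset.sum_congr rfl fun a _ => by ring

/-- The weighted vector quadratic form is nonnegative for nonnegative weights. [folklore] -/
private theorem vecGradFormW_self_nonneg {w : Sym2 V → ℝ} (hw : ∀ e, 0 ≤ w e) (f : V → Fin ν → ℝ) :
    0 ≤ vecGradFormW G w f f := by
  unfold vecGradFormW
  refine Finset.sum_nonneg fun e _ => mul_nonneg (hw e) ?_
  induction e using Sym2.ind with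
  | _ x y =>
    simp only [Sym2.lift_mk]
    exact Finset.sum_nonneg fun a _ => by nlinarith

/-- The weighted vector bond form is continuous in its first argument. [folklore] -/
private theorem continuous_vecGradFormW_left (w : Sym2 V → ℝ) (g : V → Fin ν → ℝ) :
    Continuous fun f : V → Fin ν → ℝ => vecGradFormW G w f g := by
  unfold vecGradFormW
  refine continuous_finsetSum _ fun e _ => ?_
  induction e using Sym2.ind with
  | _ x y => simp only [Sym2.lift_mk]; fun_prop

/-- The weighted vector quadratic form is continuous. [folklore] -/
private theorem continuous_vecGradFormW_self (w : Sym2 V → ℝ) :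
    Continuous fun f : V → Fin ν → ℝ => vecGradFormW G w f f := by
  unfold vecGradFormW
  refine continuous_finsetSum _ fun e _ => ?_
  induction e using Sym2.ind with
  | _ x y => simp only [Sym2.lift_mk]; fun_prop

variable (G) (w : Sym2 V → ℝ) (ρ : Measure (Fin ν → ℝ)) (β : ℝ)

/-- **The functional `Z_w(h)` of Gaussian domination with edge weights**:
`Z_w(h) = ∫ exp{−β ∑_{e={x,y}} w_e ‖ω_x − ω_y + h_x − h_y‖²} dμ₀(ω)`, `μ₀ = ⊗_V ρ`
(Fröhlich–Israel–Lieb–Simon's `Z(h_α)` of Thm. 4.6 with `J` supported on the edges of `G`).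
[cite: FILS1978, Thm. 4.6 (Z(h_α))] -/
def vZW (h : V → Fin ν → ℝ) : ℝ :=
  ∫ ω, Real.exp (-β * vecGradFormW G w (ω + h) (ω + h)) ∂(Measure.pi fun _ : V => ρ)

variable {G w ρ β}

/-- The integrand of `Z_w(h)` is continuous. [folklore] -/
private theorem continuous_vZW_integrand (w : Sym2 V → ℝ) (β : ℝ) (h : V → Fin ν → ℝ) :
    Continuous fun ω : V → Fin ν → ℝ => Real.exp (-β * vecGradFormW G w (ω + h) (ω + h)) :=
  ((continuous_vecGradFormW_self (G := G) w).comp (continuous_id.add continuous_const)).const_mul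
    (-β) |>.rexp

/-- The integrand of `Z_w(h)` is at most `1` for `β ≥ 0`, `w ≥ 0`. [folklore] -/
private theorem vZW_integrand_le_one {w : Sym2 V → ℝ} (hw : ∀ e, 0 ≤ w e) {β : ℝ} (hβ : 0 ≤ β)
    (h ω : V → Fin ν → ℝ) :
    Real.exp (-β * vecGradFormW G w (ω + h) (ω + h)) ≤ 1 := by
  rw [Real.exp_le_one_iff, neg_mul, neg_nonpos]
  exact mul_nonneg hβ (vecGradFormW_self_nonneg hw _)

/-- The integrand of `Z_w(h)` is integrable (`β ≥ 0`, `w ≥ 0`, `ρ` finite). [folklore] -/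
private theorem integrable_vZW_integrand [IsFiniteMeasure ρ] {w : Sym2 V → ℝ} (hw : ∀ e, 0 ≤ w e) {β : ℝ}
    (hβ : 0 ≤ β) (h : V → Fin ν → ℝ) :
    Integrable (fun ω : V → Fin ν → ℝ => Real.exp (-β * vecGradFormW G w (ω + h) (ω + h)))
      (Measure.pi fun _ : V => ρ) := by
  refine (integrable_const (1 : ℝ)).mono' (continuous_vZW_integrand w β h).aestronglyMeasurable
    (ae_of_all _ fun ω => ?_)
  rw [Real.norm_eq_abs, abs_of_pos (Real.exp_pos _)]
  exact vZW_integrand_le_one hw hβ h ω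

/-- `Z_w(h) > 0` (`β ≥ 0`, `w ≥ 0`, `ρ` finite and nonzero). [folklore] -/
private theorem vZW_pos [IsFiniteMeasure ρ] (hρ : ρ ≠ 0) {w : Sym2 V → ℝ} (hw : ∀ e, 0 ≤ w e) {β : ℝ}
    (hβ : 0 ≤ β) (h : V → Fin ν → ℝ) :
    0 < vZW G w ρ β h := by
  haveI : NeZero (Measure.pi fun _ : V => ρ) := ⟨pi_ne_zero ρ hρ⟩
  exact integral_exp_pos (integrable_vZW_integrand hw hβ h)

end VectorForms

/-! ### Reflections: the weighted half exponent and two-half kernel, `Z_w(h)² ≤ Z_w(h⁺)Z_w(h⁻)` -/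

section Reflection

variable {V : Type*} [Fintype V] [DecidableEq V] (G : SimpleGraph V) [DecidableRel G.Adj]
  (θ : V ≃ V) (P : Finset V) {ν : ℕ} (w : Sym2 V → ℝ)

/-- The weighted half exponent
`−β[∑_{{x,y} ⊆ 𝕋₊} w_{xy}‖ω_x − ω_y + g_x − g_y‖² + ∑_{x crossing} w_{x,θx}‖ω_x + g_x‖²]`.
[cite: FriedliVelenik2017, §10.5.3, proof of Prop. 10.27] -/
def halfExpW (β : ℝ) (g ω : V → Fin ν → ℝ) : ℝ :=
  -β * (∑ e ∈ innerEdges G P, w e *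
      Sym2.lift ⟨fun x y => ∑ a, (ω x a + g x a - (ω y a + g y a)) ^ 2, fun x y =>
        Finset.sum_congr rfl fun a _ => by ring⟩ e +
    ∑ x ∈ crossSites G θ P, w s(x, θ x) * ∑ a, (ω x a + g x a) ^ 2)

/-- The weighted two-half kernel
`e^{A_{g₁}(τ)} e^{A_{g₂}(τ')} e^{2β ∑_{x crossing} w_{x,θx}(τ_x + g₁(x))·(τ'_x + g₂(x))}`.
[cite: FriedliVelenik2017, Lemma 10.28 and proof of Prop. 10.27] -/
def pairKernelW (β : ℝ) (g₁ g₂ : V → Fin ν → ℝ)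
    (z : (↥P → Fin ν → ℝ) × (↥P → Fin ν → ℝ)) : ℝ :=
  Real.exp (halfExpW G θ P w β g₁ (extCfg P z.1)) * Real.exp (halfExpW G θ P w β g₂ (extCfg P z.2)) *
    Real.exp (2 * β * ∑ x ∈ crossSites G θ P, w s(x, θ x) * ∑ a,
      (extCfg P z.1 x a + g₁ x a) * (extCfg P z.2 x a + g₂ x a))

/-- The weighted two-half functional as an integral over pairs of half configurations.
[cite: FriedliVelenik2017, Lemma 10.28 and proof of Prop. 10.27] -/
def pairIntW (ρ : Measure (Fin ν → ℝ)) (β : ℝ) (g₁ g₂ : V → Fin ν → ℝ) : ℝ :=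
  ∫ z, pairKernelW G θ P w β g₁ g₂ z
    ∂((Measure.pi fun _ : ↥P => ρ).prod (Measure.pi fun _ : ↥P => ρ))

variable {G θ P w}

/-- The weighted half exponent depends on the field and the configuration only through their values
on `𝕋₊`. [folklore] -/
private theorem halfExpW_congr (β : ℝ) {g g' ω ω' : V → Fin ν → ℝ} (hg : ∀ x ∈ P, g x = g' x)
    (hω : ∀ x ∈ P, ω x = ω' x) :
    halfExpW G θ P w β g ω = halfExpW G θ P w β g' ω' := by
  unfold halfExpW
  congr 2
  · refine Finset.sum_congr rfl fun e he => ?_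
    have hmem := fun z => mem_of_mem_innerEdges (G := G) (P := P) he (z := z)
    revert hmem
    induction e using Sym2.ind with
    | _ x y =>
      intro hmem
      simp only [Sym2.lift_mk]
      rw [hg x (hmem x (Sym2.mem_mk_left x y)), hg y (hmem y (Sym2.mem_mk_right x y)),
        hω x (hmem x (Sym2.mem_mk_left x y)), hω y (hmem y (Sym2.mem_mk_right x y))]
  · exact Finset.sum_congr rfl fun x hx => by
      rw [hg x (mem_of_mem_crossSites hx), hω x (mem_of_mem_crossSites hx)]

/-- The weighted half exponent is nonpositive for `β ≥ 0`, `w ≥ 0`. [folklore] -/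
private theorem halfExpW_nonpos {β : ℝ} (hβ : 0 ≤ β) (hw : ∀ e, 0 ≤ w e) (g ω : V → Fin ν → ℝ) :
    halfExpW G θ P w β g ω ≤ 0 := by
  unfold halfExpW
  rw [neg_mul, neg_nonpos]
  refine mul_nonneg hβ (add_nonneg (Finset.sum_nonneg fun e _ => mul_nonneg (hw e) ?_)
    (Finset.sum_nonneg fun x _ => mul_nonneg (hw _)
      (Finset.sum_nonneg fun a _ => sq_nonneg _)))
  induction e using Sym2.ind with
  | _ x y =>
    simp only [Sym2.lift_mk]
    exact Finset.sum_nonneg fun a _ => sq_nonneg _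

/-- The weighted half exponent is continuous in the configuration. [folklore] -/
private theorem continuous_halfExpW (β : ℝ) (g : V → Fin ν → ℝ) :
    Continuous fun ω : V → Fin ν → ℝ => halfExpW G θ P w β g ω := by
  unfold halfExpW
  refine (Continuous.add (continuous_finsetSum _ fun e _ => ?_) (by fun_prop)).const_mul _
  induction e using Sym2.ind with
  | _ x y => simp only [Sym2.lift_mk]; fun_prop

/-- `pairIntW` depends on the fields only through their values on `𝕋₊`. [folklore] -/
private theorem pairIntW_congr (ρ : Measure (Fin ν → ℝ)) (β : ℝ) {g₁ g₁' g₂ g₂' : V → Fin ν → ℝ}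
    (h₁ : ∀ x ∈ P, g₁ x = g₁' x) (h₂ : ∀ x ∈ P, g₂ x = g₂' x) :
    pairIntW G θ P w ρ β g₁ g₂ = pairIntW G θ P w ρ β g₁' g₂' := by
  unfold pairIntW pairKernelW
  refine integral_congr_ae (ae_of_all _ fun z => ?_)
  simp only
  rw [halfExpW_congr β h₁ fun _ _ => rfl, halfExpW_congr β h₂ fun _ _ => rfl,
    Finset.sum_congr rfl fun x hx => by
      rw [h₁ x (mem_of_mem_crossSites hx), h₂ x (mem_of_mem_crossSites hx)]]

/-- **The weighted exponent split along a reflection**: for an edge weight invariant under the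
reflection, `−β𝓔_w(ω+g) = A_w + Θ(B_w) + 2β∑_{x crossing} w_{x,θx}(ω_x + g_x)·(ω_{θx} + g_{θx})`.
[cite: FriedliVelenik2017, §10.5.3, proof of Prop. 10.27] -/
theorem exponent_splitW (hθ : ∀ x, θ (θ x) = x) (hadj : ∀ x y, G.Adj (θ x) (θ y) ↔ G.Adj x y)
    (hP : ∀ x, x ∈ P ↔ θ x ∉ P) (hcross : ∀ x y, x ∈ P → y ∉ P → G.Adj x y → y = θ x)
    (hwθ : ∀ e ∈ G.edgeFinset, w (Sym2.map θ e) = w e)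
    (β : ℝ) (g ω : V → Fin ν → ℝ) :
    -β * vecGradFormW G w (ω + g) (ω + g) =
      halfExpW G θ P w β g ω + halfExpW G θ P w β (g ∘ θ) (ω ∘ θ) +
        2 * β * ∑ x ∈ crossSites G θ P, w s(x, θ x) * ∑ a,
          (ω x a + g x a) * ((ω ∘ θ) x a + (g ∘ θ) x a) := by
  unfold vecGradFormW
  rw [sum_edgeFinset_reflect_split hθ hadj hP hcross]
  unfold halfExpW
  have hin : ∑ e ∈ innerEdges G P, w e * Sym2.lift ⟨fun x y => ∑ a,
      ((ω + g) x a - (ω + g) y a) * ((ω + g) x a - (ω + g) y a), fun x y =>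
        Finset.sum_congr rfl fun a _ => by ring⟩ e =
      ∑ e ∈ innerEdges G P, w e * Sym2.lift ⟨fun x y => ∑ a, (ω x a + g x a - (ω y a + g y a)) ^ 2,
        fun x y => Finset.sum_congr rfl fun a _ => by ring⟩ e := by
    refine Finset.sum_congr rfl fun e _ => ?_
    induction e using Sym2.ind with
    | _ x y =>
      simp only [Sym2.lift_mk, Pi.add_apply]
      congr 1
      exact Finset.sum_congr rfl fun a _ => by ring
  have hout : ∑ e ∈ innerEdges G P, w (Sym2.map θ e) * Sym2.lift ⟨fun x y => ∑ a,
      ((ω + g) x a - (ω + g) y a) * ((ω + g) x a - (ω + g) y a), fun x y =>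
        Finset.sum_congr rfl fun a _ => by ring⟩ (Sym2.map θ e) =
      ∑ e ∈ innerEdges G P, w e * Sym2.lift ⟨fun x y => ∑ a,
        ((ω ∘ θ) x a + (g ∘ θ) x a - ((ω ∘ θ) y a + (g ∘ θ) y a)) ^ 2,
          fun x y => Finset.sum_congr rfl fun a _ => by ring⟩ e := by
    refine Finset.sum_congr rfl fun e he => ?_
    rw [hwθ e (Finset.mem_filter.1 he).1]
    induction e using Sym2.ind with
    | _ x y =>
      rw [Sym2.map_mk]
      simp only [Sym2.lift_mk, Pi.add_apply, Function.comp_apply]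
      congr 1
      exact Finset.sum_congr rfl fun a _ => by ring
  have hcr : ∑ x ∈ crossSites G θ P, w (s(x, θ x)) * Sym2.lift ⟨fun x y => ∑ a,
      ((ω + g) x a - (ω + g) y a) * ((ω + g) x a - (ω + g) y a), fun x y =>
        Finset.sum_congr rfl fun a _ => by ring⟩ s(x, θ x) =
      ∑ x ∈ crossSites G θ P, w s(x, θ x) * ∑ a, (ω x a + g x a) ^ 2 +
        ∑ x ∈ crossSites G θ P, w s(x, θ x) * ∑ a, ((ω ∘ θ) x a + (g ∘ θ) x a) ^ 2 -
          2 * ∑ x ∈ crossSites G θ P, w s(x, θ x) * ∑ a,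
            (ω x a + g x a) * ((ω ∘ θ) x a + (g ∘ θ) x a) := by
    rw [Finset.mul_sum, ← Finset.sum_add_distrib, ← Finset.sum_sub_distrib]
    refine Finset.sum_congr rfl fun x _ => ?_
    simp only [Sym2.lift_mk, Pi.add_apply, Function.comp_apply, Finset.mul_sum]
    rw [← Finset.sum_add_distrib, ← Finset.sum_sub_distrib]
    exact Finset.sum_congr rfl fun a _ => by ring
  rw [hin, hout, hcr]
  ring

/-- The integrand of `Z_w(h)` is the weighted two-half kernel at the split configuration.
[cite: FriedliVelenik2017, §10.5.3, proof of Prop. 10.27] -/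
theorem exp_neg_mul_vecGradFormW_eq_pairKernelW (hθ : ∀ x, θ (θ x) = x)
    (hadj : ∀ x y, G.Adj (θ x) (θ y) ↔ G.Adj x y) (hP : ∀ x, x ∈ P ↔ θ x ∉ P)
    (hcross : ∀ x y, x ∈ P → y ∉ P → G.Adj x y → y = θ x)
    (hwθ : ∀ e ∈ G.edgeFinset, w (Sym2.map θ e) = w e) (β : ℝ) (g ω : V → Fin ν → ℝ) :
    Real.exp (-β * vecGradFormW G w (ω + g) (ω + g)) =
      pairKernelW G θ P w β g (g ∘ θ) (fun x => ω x, fun x => ω (θ x)) := by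
  rw [exponent_splitW hθ hadj hP hcross hwθ, Real.exp_add, Real.exp_add, pairKernelW]
  have h1 : ∀ x ∈ P, ω x = extCfg P (fun x : ↥P => ω x) x := fun x hx => by
    rw [extCfg_apply_of_mem _ hx]
  have h2 : ∀ x ∈ P, (ω ∘ θ) x = extCfg P (fun x : ↥P => ω (θ x)) x := fun x hx => by
    rw [extCfg_apply_of_mem _ hx, Function.comp_apply]
  rw [halfExpW_congr β (fun _ _ => rfl) h1, halfExpW_congr β (fun _ _ => rfl) h2]
  congr 3
  refine Finset.sum_congr rfl fun x hx => ?_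
  congr 1
  refine Finset.sum_congr rfl fun a _ => ?_
  rw [h1 x (mem_of_mem_crossSites hx), h2 x (mem_of_mem_crossSites hx)]

/-- `Z_w(h) = pairIntW(h, h ∘ θ)` in two-half form. [cite: FriedliVelenik2017, §10.5.3, proof of Prop. 10.27] -/
theorem vZW_eq_pairIntW (hθ : ∀ x, θ (θ x) = x) (hadj : ∀ x y, G.Adj (θ x) (θ y) ↔ G.Adj x y)
    (hP : ∀ x, x ∈ P ↔ θ x ∉ P) (hcross : ∀ x y, x ∈ P → y ∉ P → G.Adj x y → y = θ x)
    (hwθ : ∀ e ∈ G.edgeFinset, w (Sym2.map θ e) = w e)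
    (ρ : Measure (Fin ν → ℝ)) [SigmaFinite ρ] (β : ℝ) (g : V → Fin ν → ℝ) :
    vZW G w ρ β g = pairIntW G θ P w ρ β g (g ∘ θ) := by
  unfold vZW pairIntW
  rw [← (measurePreserving_splitEquiv hθ hP ρ).integral_comp']
  refine integral_congr_ae (ae_of_all _ fun ω => ?_)
  simp only
  rw [exp_neg_mul_vecGradFormW_eq_pairKernelW hθ hadj hP hcross hwθ, splitEquiv_apply]

/-- `√w ≤ 1 + w` for `w ≥ 0`. [folklore] -/
private theorem sqrt_le_one_add {x : ℝ} (hx : 0 ≤ x) : Real.sqrt x ≤ 1 + x := by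
  have h1 : 0 ≤ 1 + x := by linarith
  calc Real.sqrt x ≤ Real.sqrt ((1 + x) ^ 2) := Real.sqrt_le_sqrt (by nlinarith)
    _ = 1 + x := Real.sqrt_sq h1

/-- **Lemma 10.28 for the weighted two-half functional**:
`pairIntW(g₁,g₂)² ≤ pairIntW(g₁,g₁) pairIntW(g₂,g₂)` for `β ≥ 0`, `w ≥ 0` and a finite, compactly
supported single-spin measure (`kerInt_sq_le` with the features
`(τ, (x,a)) ↦ √w_{x,θx}(τ_x^a + g_x^a)`, `x` crossing). [cite: FriedliVelenik2017, Lemma 10.28] -/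
theorem pairIntW_sq_le (hw : ∀ e, 0 ≤ w e) (ρ : Measure (Fin ν → ℝ)) [IsFiniteMeasure ρ]
    {K : Set (Fin ν → ℝ)} (hKc : IsCompact K) (hK : ρ Kᶜ = 0) {β : ℝ} (hβ : 0 ≤ β)
    (g₁ g₂ : V → Fin ν → ℝ) :
    pairIntW G θ P w ρ β g₁ g₂ ^ 2 ≤ pairIntW G θ P w ρ β g₁ g₁ * pairIntW G θ P w ρ β g₂ g₂ := by
  set m : Measure (↥P → Fin ν → ℝ) := Measure.pi fun _ : ↥P => ρ with hm
  set Φ : (↥P → Fin ν → ℝ) → ℝ := fun τ => Real.exp (halfExpW G θ P w β g₁ (extCfg P τ)) with hΦ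
  set Ψ : (↥P → Fin ν → ℝ) → ℝ := fun τ => Real.exp (halfExpW G θ P w β g₂ (extCfg P τ)) with hΨ
  set sw : V → ℝ := fun x => Real.sqrt (w s(x, θ x)) with hsw
  have hsw2 : ∀ x, sw x * sw x = w s(x, θ x) := fun x => Real.mul_self_sqrt (hw _)
  set p : ↥(crossSites G θ P) × Fin ν → (↥P → Fin ν → ℝ) → ℝ :=
    fun c τ => sw c.1 * (extCfg P τ c.1 c.2 + g₁ c.1 c.2) with hp
  set q : ↥(crossSites G θ P) × Fin ν → (↥P → Fin ν → ℝ) → ℝ :=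
    fun c τ => sw c.1 * (extCfg P τ c.1 c.2 + g₂ c.1 c.2) with hq
  -- the three functionals are `kerInt`s
  have hker : ∀ (F₁ F₂ : (↥P → Fin ν → ℝ) → ℝ) (f₁ f₂ : V → Fin ν → ℝ),
      kerInt m (2 * β) F₁ F₂
        (fun (c : ↥(crossSites G θ P) × Fin ν) τ => sw c.1 * (extCfg P τ c.1 c.2 + f₁ c.1 c.2))
        (fun (c : ↥(crossSites G θ P) × Fin ν) τ => sw c.1 * (extCfg P τ c.1 c.2 + f₂ c.1 c.2)) =
      ∫ z, F₁ z.1 * F₂ z.2 * Real.exp (2 * β * ∑ x ∈ crossSites G θ P, w s(x, θ x) * ∑ a,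
        (extCfg P z.1 x a + f₁ x a) * (extCfg P z.2 x a + f₂ x a)) ∂(m.prod m) := by
    intro F₁ F₂ f₁ f₂
    unfold kerInt
    refine integral_congr_ae (ae_of_all _ fun z => ?_)
    have hs : ∑ c : ↥(crossSites G θ P) × Fin ν,
        sw c.1 * (extCfg P z.1 c.1 c.2 + f₁ c.1 c.2) * (sw c.1 * (extCfg P z.2 c.1 c.2 + f₂ c.1 c.2)) =
        ∑ x ∈ crossSites G θ P, w s(x, θ x) * ∑ a,
          (extCfg P z.1 x a + f₁ x a) * (extCfg P z.2 x a + f₂ x a) := by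
      rw [Fintype.sum_prod_type, ← Finset.sum_coe_sort (crossSites G θ P)]
      refine Finset.sum_congr rfl fun x _ => ?_
      dsimp only
      rw [← hsw2, Finset.mul_sum]
      exact Finset.sum_congr rfl fun a _ => by ring
    simp only [hs]
  have e12 : pairIntW G θ P w ρ β g₁ g₂ = kerInt m (2 * β) Φ Ψ p q := by rw [hker]; rfl
  have e11 : pairIntW G θ P w ρ β g₁ g₁ = kerInt m (2 * β) Φ Φ p p := by rw [hker]; rfl
  have e22 : pairIntW G θ P w ρ β g₂ g₂ = kerInt m (2 * β) Ψ Ψ q q := by rw [hker]; rfl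
  rw [e12, e11, e22]
  -- bounds
  obtain ⟨RK, hRK0, hRK⟩ := exists_abs_apply_le_of_isCompact hKc
  set Rg : ℝ := ∑ y, ∑ b, |g₁ y b| + ∑ y, ∑ b, |g₂ y b| with hRg
  have hRg0 : 0 ≤ Rg := add_nonneg (Finset.sum_nonneg fun _ _ => Finset.sum_nonneg fun _ _ =>
    abs_nonneg _) (Finset.sum_nonneg fun _ _ => Finset.sum_nonneg fun _ _ => abs_nonneg _)
  set W : ℝ := 1 + ∑ x ∈ crossSites G θ P, w s(x, θ x) with hW
  have hW1 : 1 ≤ W := le_add_of_nonneg_right (Finset.sum_nonneg fun x _ => hw _)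
  have hswW : ∀ x ∈ crossSites G θ P, sw x ≤ W := by
    intro x hx
    calc sw x ≤ 1 + w s(x, θ x) := sqrt_le_one_add (hw _)
      _ ≤ W := add_le_add le_rfl
          (Finset.single_le_sum (f := fun y => w s(y, θ y)) (fun y _ => hw _) hx)
  have hsw0 : ∀ x, 0 ≤ sw x := fun x => Real.sqrt_nonneg _
  set R : ℝ := W * max 1 (RK + Rg) with hR
  have hR1 : 1 ≤ R := by
    calc (1 : ℝ) = 1 * 1 := by ring
      _ ≤ W * max 1 (RK + Rg) := mul_le_mul hW1 (le_max_left _ _) zero_le_one (by linarith)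
  have hR0 : 0 ≤ R := le_trans zero_le_one hR1
  have hΦb : ∀ (f : V → Fin ν → ℝ), ∀ᵐ τ ∂m, |Real.exp (halfExpW G θ P w β f (extCfg P τ))| ≤ R := by
    intro f
    refine ae_of_all _ fun τ => ?_
    rw [abs_of_pos (Real.exp_pos _)]
    exact (Real.exp_le_one_iff.2 (halfExpW_nonpos hβ hw _ _)).trans hR1
  have hmem := ae_pi_forall_mem (ι := ↥P) ρ hK
  have hpb : ∀ (f : V → Fin ν → ℝ), (∀ y b, |f y b| ≤ Rg) →
      ∀ᵐ τ ∂m, ∀ c : ↥(crossSites G θ P) × Fin ν,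
        |sw c.1 * (extCfg P τ c.1 c.2 + f c.1 c.2)| ≤ R := by
    intro f hf
    filter_upwards [hmem] with τ hτ c
    have hx : (c.1 : V) ∈ P := mem_of_mem_crossSites c.1.2
    rw [extCfg_apply_of_mem _ hx, abs_mul, abs_of_nonneg (hsw0 _)]
    have h1 : |τ ⟨c.1, hx⟩ c.2 + f c.1 c.2| ≤ max 1 (RK + Rg) :=
      calc |τ ⟨c.1, hx⟩ c.2 + f c.1 c.2| ≤ |τ ⟨c.1, hx⟩ c.2| + |f c.1 c.2| := abs_add_le _ _
        _ ≤ RK + Rg := add_le_add (hRK _ (hτ _) _) (hf _ _)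
        _ ≤ max 1 (RK + Rg) := le_max_right _ _
    exact mul_le_mul (hswW _ c.1.2) h1 (abs_nonneg _) (le_trans zero_le_one hW1)
  have hg₁ : ∀ y b, |g₁ y b| ≤ Rg := fun y b =>
    (abs_apply_le_sum_abs g₁ y b).trans (le_add_of_nonneg_right
      (Finset.sum_nonneg fun _ _ => Finset.sum_nonneg fun _ _ => abs_nonneg _))
  have hg₂ : ∀ y b, |g₂ y b| ≤ Rg := fun y b =>
    (abs_apply_le_sum_abs g₂ y b).trans (le_add_of_nonneg_left
      (Finset.sum_nonneg fun _ _ => Finset.sum_nonneg fun _ _ => abs_nonneg _))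
  -- measurability
  have hΦm : ∀ f : V → Fin ν → ℝ, Measurable fun τ : ↥P → Fin ν → ℝ =>
      Real.exp (halfExpW G θ P w β f (extCfg P τ)) := fun f =>
    (Real.continuous_exp.comp ((continuous_halfExpW β f).comp continuous_extCfg)).measurable
  have hpm : ∀ (f : V → Fin ν → ℝ) (c : ↥(crossSites G θ P) × Fin ν),
      Measurable fun τ : ↥P → Fin ν → ℝ => sw c.1 * (extCfg P τ c.1 c.2 + f c.1 c.2) := fun f c =>
    (continuous_const.mul (((continuous_apply c.2).comp ((continuous_apply (c.1 : V)).comp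
      continuous_extCfg)).add continuous_const)).measurable
  exact kerInt_sq_le (mul_nonneg zero_le_two hβ) (hΦm g₁) (hΦm g₂) (hpm g₁) (hpm g₂) hR0
    (hΦb g₁) (hΦb g₂) (hpb g₁ hg₁) (hpb g₂ hg₂)

/-- **`Z_w(h)² ≤ Z_w(h⁺) Z_w(h⁻)`** for a reflection of a finite graph (involutive automorphism
exchanging `𝕋₊` and its complement, crossing edges `{x, θx}`), an invariant nonnegative edge weight,
`β ≥ 0`, and a finite compactly supported single-spin measure — the reflection-positivity step of
Fröhlich–Israel–Lieb–Simon's Thm. 4.6 for couplings on the edges of `G`.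
[cite: FILS1978, Thm. 4.6] [cite: FriedliVelenik2017, §10.5.3, proof of Prop. 10.27] -/
theorem vZW_sq_le_reflect (hθ : ∀ x, θ (θ x) = x) (hadj : ∀ x y, G.Adj (θ x) (θ y) ↔ G.Adj x y)
    (hP : ∀ x, x ∈ P ↔ θ x ∉ P) (hcross : ∀ x y, x ∈ P → y ∉ P → G.Adj x y → y = θ x)
    (hwθ : ∀ e ∈ G.edgeFinset, w (Sym2.map θ e) = w e) (hw : ∀ e, 0 ≤ w e)
    (ρ : Measure (Fin ν → ℝ)) [IsFiniteMeasure ρ] {K : Set (Fin ν → ℝ)} (hKc : IsCompact K)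
    (hK : ρ Kᶜ = 0) {β : ℝ} (hβ : 0 ≤ β) (h : V → Fin ν → ℝ) :
    vZW G w ρ β h ^ 2 ≤
      vZW G w ρ β (NVector.reflPlus θ P h) * vZW G w ρ β (NVector.reflMinus θ P h) := by
  rw [vZW_eq_pairIntW hθ hadj hP hcross hwθ ρ β h,
    vZW_eq_pairIntW hθ hadj hP hcross hwθ ρ β (NVector.reflPlus θ P h),
    vZW_eq_pairIntW hθ hadj hP hcross hwθ ρ β (NVector.reflMinus θ P h)]
  have hplus : pairIntW G θ P w ρ β (NVector.reflPlus θ P h) (NVector.reflPlus θ P h ∘ θ) =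
      pairIntW G θ P w ρ β h h := by
    refine pairIntW_congr ρ β (fun x hx => by simp [NVector.reflPlus, hx]) (fun x hx => ?_)
    have hθx : θ x ∉ P := (hP x).1 hx
    simp [NVector.reflPlus, hθx, hθ]
  have hminus : pairIntW G θ P w ρ β (NVector.reflMinus θ P h) (NVector.reflMinus θ P h ∘ θ) =
      pairIntW G θ P w ρ β (h ∘ θ) (h ∘ θ) := by
    refine pairIntW_congr ρ β (fun x hx => by simp [NVector.reflMinus, hx]) (fun x hx => ?_)
    have hθx : θ x ∉ P := (hP x).1 hx
    simp [NVector.reflMinus, hθx]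
  rw [hplus, hminus]
  exact pairIntW_sq_le hw ρ hKc hK hβ h (h ∘ θ)

omit [DecidableEq V] in
/-- A field without bad bonds does not change `Z_w`: `N(g) = 0 ⇒ Z_w(g) = Z_w(0)`.
[cite: FriedliVelenik2017, §10.5.3, proof of Prop. 10.27] -/
theorem vZW_eq_vZW_zero_of_vbadBonds_eq_zero (ρ : Measure (Fin ν → ℝ)) (β : ℝ)
    {g : V → Fin ν → ℝ} (hg : vbadBonds G g = 0) : vZW G w ρ β g = vZW G w ρ β 0 := by
  unfold vZW
  refine integral_congr_ae (ae_of_all _ fun ω => ?_)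
  simp only
  congr 2
  unfold vecGradFormW
  refine Finset.sum_congr rfl fun e he => ?_
  have hterm := (Finset.sum_eq_zero_iff.1 hg) e he
  induction e using Sym2.ind with
  | _ x y =>
    rw [vbadInd_mk] at hterm
    have hxy : g x = g y := by
      by_contra h
      rw [if_neg h] at hterm
      exact one_ne_zero hterm
    simp only [Sym2.lift_mk, Pi.add_apply, Pi.zero_apply, add_zero, hxy]
    congr 1
    exact Finset.sum_congr rfl fun a _ => by ring

end Reflection

/-! ### The torus: direction weights and their reflection invariance -/

section DirWeight

variable {d L : ℕ}

/-- **The direction weight** of a pair of torus sites: `K_i` if the pair is a nearest-neighbour bond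
in direction `i` (`y − x = ±eᵢ`), `0` otherwise; on the edges `{x, x + eᵢ}` of the torus graph
(`L ≥ 3`) it is `K_i` (`dirWeight_mk_add_single`). This is the nearest-neighbour coupling with
direction-dependent strengths of Fröhlich–Israel–Lieb–Simon §3 (C). [cite: FILS1978, §3 (C) eq. (3.6)] -/
def dirWeight (K : Fin d → ℝ) : Sym2 (TorusSite d L) → ℝ :=
  Sym2.lift ⟨fun x y => ∑ i, if (y - x = Pi.single i 1 ∨ x - y = Pi.single i 1) then K i else 0,
    fun x y => Finset.sum_congr rfl fun i _ => by simp only [or_comm]⟩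

/-- Value of the direction weight on a pair. [folklore] -/
private theorem dirWeight_mk (K : Fin d → ℝ) (x y : TorusSite d L) :
    dirWeight K s(x, y) = ∑ i, if (y - x = Pi.single i 1 ∨ x - y = Pi.single i 1) then K i else 0 :=
  rfl

/-- The direction weight is nonnegative for nonnegative couplings. [folklore] -/
private theorem dirWeight_nonneg {K : Fin d → ℝ} (hK : ∀ i, 0 ≤ K i) (e : Sym2 (TorusSite d L)) :
    0 ≤ dirWeight K e := by
  induction e using Sym2.ind with
  | _ x y =>
    rw [dirWeight_mk]
    exact Finset.sum_nonneg fun i _ => by split_ifs <;> simp [hK i]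

/-- **On the torus edge `{x, x + eᵢ}` the direction weight is `K_i`** (`L ≥ 3`: `eᵢ ≠ e_j` for
`j ≠ i` and `eᵢ + e_j ≠ 0`). [cite: FILS1978, §3 (C) eq. (3.6)] -/
theorem dirWeight_mk_add_single [NeZero L] (hL : 3 ≤ L) (K : Fin d → ℝ) (x : TorusSite d L)
    (i : Fin d) : dirWeight K s(x, x + Pi.single i 1) = K i := by
  have hL2 : 2 ≤ L := by omega
  rw [dirWeight_mk, Finset.sum_eq_single i]
  · simp
  · intro j _ hji
    simp only [add_sub_cancel_left, sub_add_cancel_left]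
    rw [if_neg]
    rintro (h | h)
    · exact hji (torus_single_injective hL2 h).symm
    · exact torus_single_add_single_ne_zero hL i j (by rw [← h, add_neg_cancel])
  · intro hi; exact absurd (Finset.mem_univ i) hi

/-- **The direction weight is invariant under every reflection between sites** on the edges of the
torus graph (`L ≥ 3`): a reflected bond has the same direction. [cite: FILS1978, §3 (C) eq. (3.6)] -/
theorem dirWeight_map_reflectBetweenSites [NeZero L] (hL : 3 ≤ L) (K : Fin d → ℝ) (j : Fin d)
    (c : ZMod L) :
    ∀ e ∈ (torusGraph d L).edgeFinset,
      dirWeight K (Sym2.map (Torus.reflectBetweenSites (d := d) (L := L) j c) e) = dirWeight K e := by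
  intro e he
  -- write the edge as `{x, x + eᵢ}`
  obtain ⟨x, i, rfl⟩ : ∃ (x : TorusSite d L) (i : Fin d), e = s(x, x + Pi.single i 1) := by
    induction e using Sym2.ind with
    | _ a b =>
      have hab : (torusGraph d L).Adj a b := SimpleGraph.mem_edgeFinset.1 he
      rw [torusGraph_adj_iff] at hab
      rcases hab.2 with ⟨i, rfl⟩ | ⟨i, rfl⟩
      · exact ⟨a, i, rfl⟩
      · exact ⟨b, i, Sym2.eq_swap⟩
  rw [Sym2.map_mk, dirWeight_mk_add_single hL K x i]
  by_cases hij : i = j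
  · rw [hij, Torus.reflectBetweenSites_eq_add_single j c x, Sym2.eq_swap,
      dirWeight_mk_add_single hL]
  · rw [Torus.reflectBetweenSites_add_single_of_ne j c x hij, dirWeight_mk_add_single hL]

end DirWeight

/-! ### Gaussian domination on the even torus with direction-dependent couplings -/

section TorusDescent

variable {d L : ℕ} [NeZero L] {ν : ℕ}

/-- **Gaussian domination on the even torus, direction-dependent couplings** (Fröhlich–Israel–Lieb–
Simon 1978, Thm. 4.6 `Z(h_α) ≤ Z(0)` for the reflection-positive nearest-neighbour coupling with one
constant per direction, §3 (C); proof = Friedli–Velenik's descent, Prop. 10.27): for `ν`-component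
spins with a finite, nonzero, compactly supported single-spin measure, `L` even, `L ≥ 4`, `β ≥ 0`,
`K ≥ 0`, and every field `h`, `Z_{β,K}(h) ≤ Z_{β,K}(0)`.
[cite: FILS1978, Thm. 4.6 with §3 (C)] [cite: FriedliVelenik2017, Prop. 10.27, eq. (10.43)] -/
theorem vZW_le_vZW_zero (hL : Even L) (hL4 : 4 ≤ L) (ρ : Measure (Fin ν → ℝ)) [IsFiniteMeasure ρ]
    {K₀ : Set (Fin ν → ℝ)} (hKc : IsCompact K₀) (hK : ρ K₀ᶜ = 0) (hρ : ρ ≠ 0) {β : ℝ} (hβ : 0 ≤ β)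
    {K : Fin d → ℝ} (hKn : ∀ i, 0 ≤ K i) (h : TorusSite d L → Fin ν → ℝ) :
    vZW (torusGraph d L) (dirWeight K) ρ β h ≤ vZW (torusGraph d L) (dirWeight K) ρ β 0 := by
  classical
  set Gr := torusGraph d L
  set w : Sym2 (TorusSite d L) → ℝ := dirWeight K with hwdef
  have hw0 : ∀ e, 0 ≤ w e := dirWeight_nonneg hKn
  have hL3 : 3 ≤ L := by omega
  -- the finite set of fields with values in the range of `h`
  set R : Finset (Fin ν → ℝ) := Finset.univ.image h with hR
  set F : Finset (TorusSite d L → Fin ν → ℝ) := Fintype.piFinset fun _ => R with hF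
  have hhF : h ∈ F := by
    rw [hF, Fintype.mem_piFinset]
    intro x
    exact Finset.mem_image_of_mem h (Finset.mem_univ x)
  have hFne : F.Nonempty := ⟨h, hhF⟩
  obtain ⟨g₀, hg₀F, hg₀max⟩ := Finset.exists_max_image F (vZW Gr w ρ β) hFne
  set Fmax := F.filter fun g => vZW Gr w ρ β g = vZW Gr w ρ β g₀ with hFmax
  have hFmaxne : Fmax.Nonempty := ⟨g₀, by simp [hFmax, hg₀F]⟩
  obtain ⟨g, hgFmax, hgmin⟩ := Finset.exists_min_image Fmax (vbadBonds Gr) hFmaxne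
  obtain ⟨hgF, hgZ⟩ := Finset.mem_filter.1 hgFmax
  have hgmax : ∀ g' ∈ F, vZW Gr w ρ β g' ≤ vZW Gr w ρ β g := fun g' hg' => hgZ ▸ hg₀max g' hg'
  -- claim: `g` has no bad bond
  have hN : vbadBonds Gr g = 0 := by
    by_contra hN0
    obtain ⟨e, he, hbad⟩ : ∃ e ∈ Gr.edgeFinset, vbadInd g e ≠ 0 := by
      by_contra hall
      push Not at hall
      exact hN0 (Finset.sum_eq_zero hall)
    obtain ⟨x, i, hxy⟩ : ∃ (x : TorusSite d L) (i : Fin d), e = s(x, x + Pi.single i 1) := by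
      induction e using Sym2.ind with
      | _ a b =>
        have hab : Gr.Adj a b := (SimpleGraph.mem_edgeFinset.1 he)
        rw [torusGraph_adj_iff] at hab
        rcases hab.2 with ⟨i, rfl⟩ | ⟨i, rfl⟩
        · exact ⟨a, i, rfl⟩
        · exact ⟨b, i, Sym2.eq_swap⟩
    subst hxy
    rw [vbadInd_mk] at hbad
    have hgx : g x ≠ g (x + Pi.single i 1) := by
      intro h'; rw [if_pos h'] at hbad; exact hbad rfl
    -- the reflection bisecting this bond
    set θ := Torus.reflectBetweenSites (d := d) (L := L) i (x i) with hθdef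
    set P := (Torus.halfBetweenSites (d := d) (L := L) i (x i)).toFinset with hPdef
    have hθθ : ∀ z, θ (θ z) = z := Torus.reflectBetweenSites_involutive i (x i)
    have hadj : ∀ a b, Gr.Adj (θ a) (θ b) ↔ Gr.Adj a b :=
      Torus.torusGraph_adj_reflectBetweenSites_iff i (x i)
    have hP : ∀ a, a ∈ P ↔ θ a ∉ P :=
      Torus.mem_halfBetweenSites_iff_reflect_not_mem hL i (x i)
    have hcross : ∀ a b, a ∈ P → b ∉ P → Gr.Adj a b → b = θ a := fun a b ha hb hab =>
      Torus.eq_reflectBetweenSites_of_adj hL hL4 i (x i) ha hb hab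
    have hwθ : ∀ e ∈ Gr.edgeFinset, w (Sym2.map θ e) = w e :=
      dirWeight_map_reflectBetweenSites hL3 K i (x i)
    obtain ⟨hyP, hθy⟩ := Torus.add_single_mem_halfBetweenSites (by omega : 2 ≤ L) i x
    have hsq := vZW_sq_le_reflect (G := Gr) (w := w) hθθ hadj hP hcross hwθ hw0 ρ hKc hK hβ g
    have hPF : NVector.reflPlus θ P g ∈ F := NVector.reflPlus_mem_piFinset hgF
    have hMF : NVector.reflMinus θ P g ∈ F := NVector.reflMinus_mem_piFinset hgF
    have hPle := hgmax _ hPF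
    have hMle := hgmax _ hMF
    have hZpos := vZW_pos (G := Gr) hρ hw0 hβ g
    have hPpos := vZW_pos (G := Gr) hρ hw0 hβ (NVector.reflPlus θ P g)
    have hMpos := vZW_pos (G := Gr) hρ hw0 hβ (NVector.reflMinus θ P g)
    have hPeq : vZW Gr w ρ β (NVector.reflPlus θ P g) = vZW Gr w ρ β g := by
      refine le_antisymm hPle ?_
      by_contra hlt
      push Not at hlt
      have : vZW Gr w ρ β (NVector.reflPlus θ P g) * vZW Gr w ρ β (NVector.reflMinus θ P g) <
          vZW Gr w ρ β g * vZW Gr w ρ β g :=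
        mul_lt_mul hlt hMle hMpos hZpos.le
      nlinarith
    have hMeq : vZW Gr w ρ β (NVector.reflMinus θ P g) = vZW Gr w ρ β g := by
      refine le_antisymm hMle ?_
      by_contra hlt
      push Not at hlt
      have : vZW Gr w ρ β (NVector.reflPlus θ P g) * vZW Gr w ρ β (NVector.reflMinus θ P g) <
          vZW Gr w ρ β g * vZW Gr w ρ β g :=
        mul_lt_mul' hPle hlt hMpos.le hZpos
      nlinarith
    have hPmin : vbadBonds Gr g ≤ vbadBonds Gr (NVector.reflPlus θ P g) :=
      hgmin _ (Finset.mem_filter.2 ⟨hPF, hPeq.trans hgZ⟩)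
    have hMmin : vbadBonds Gr g ≤ vbadBonds Gr (NVector.reflMinus θ P g) :=
      hgmin _ (Finset.mem_filter.2 ⟨hMF, hMeq.trans hgZ⟩)
    have hcount := vbadBonds_reflPlus_add_reflMinus (G := Gr) hθθ hadj hP hcross g
    have hycross : x + Pi.single i 1 ∈ crossSites Gr θ P := by
      refine Finset.mem_filter.2 ⟨hyP, ?_⟩
      rw [hθy]
      exact (torusGraph_adj_add_single (by omega) x i).symm
    have hone : (1 : ℕ) ≤ ∑ z ∈ crossSites Gr θ P, vbadInd g s(z, θ z) := by
      calc (1 : ℕ) = vbadInd g s(x + Pi.single i 1, θ (x + Pi.single i 1)) := by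
            rw [vbadInd_mk, hθy, if_neg (Ne.symm hgx)]
        _ ≤ ∑ z ∈ crossSites Gr θ P, vbadInd g s(z, θ z) :=
          Finset.single_le_sum (f := fun z => vbadInd g s(z, θ z)) (fun z _ => Nat.zero_le _) hycross
    omega
  calc vZW Gr w ρ β h ≤ vZW Gr w ρ β g := hgmax h hhF
    _ = vZW Gr w ρ β 0 := vZW_eq_vZW_zero_of_vbadBonds_eq_zero ρ β hN

end TorusDescent

/-! ### The second-order consequence of Gaussian domination ((10.46)–(10.47)), weighted -/

section SecondOrder

variable {V : Type*} [Fintype V] {G : SimpleGraph V} [DecidableRel G.Adj] {ν : ℕ} {w : Sym2 V → ℝ}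
  (ρ : Measure (Fin ν → ℝ))

/-- `Z_w(th) = e^{−βt²𝓔_w(h,h)} ∫ e^{−β𝓔_w(ω)} e^{−2βt𝓔_w(ω,h)} dμ₀`. [cite: FriedliVelenik2017, §10.5.3, proof of Thm. 10.24] -/
theorem vZW_smul (β t : ℝ) (h : V → Fin ν → ℝ) :
    vZW G w ρ β (t • h) = Real.exp (-β * t ^ 2 * vecGradFormW G w h h) *
      ∫ ω, Real.exp (-β * vecGradFormW G w ω ω) * Real.exp (-2 * β * t * vecGradFormW G w ω h)
        ∂(Measure.pi fun _ : V => ρ) := by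
  unfold vZW
  rw [← integral_const_mul]
  refine integral_congr_ae (ae_of_all _ fun ω => ?_)
  simp only
  rw [vecGradFormW_add_smul_self, ← Real.exp_add, ← Real.exp_add]
  congr 1
  ring

/-- `Z_w(0) = ∫ e^{−β𝓔_w(ω)} dμ₀`. [folklore] -/
private theorem vZW_zero (β : ℝ) :
    vZW G w ρ β 0 = ∫ ω, Real.exp (-β * vecGradFormW G w ω ω) ∂(Measure.pi fun _ : V => ρ) := by
  unfold vZW
  simp only [add_zero]

variable [IsFiniteMeasure ρ]

/-- **The second-order consequence of weighted Gaussian domination** ((10.46)–(10.47) with weights):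
if `Z_w(th) ≤ Z_w(0)` for all real `t`, `β > 0`, `w ≥ 0`, then
`2β ∫ e^{−β𝓔_w(ω)} 𝓔_w(ω,h)² dμ₀ ≤ 𝓔_w(h,h) ∫ e^{−β𝓔_w(ω)} dμ₀`.
[cite: FriedliVelenik2017, §10.5.3, proof of Thm. 10.24, (10.46)–(10.47)] -/
theorem integral_weight_vecGradFormW_sq_le {K : Set (Fin ν → ℝ)} (hKc : IsCompact K)
    (hK : ρ Kᶜ = 0) (hρ : ρ ≠ 0) (hw : ∀ e, 0 ≤ w e) {β : ℝ} (hβ : 0 < β) (h : V → Fin ν → ℝ)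
    (hGD : ∀ t : ℝ, vZW G w ρ β (t • h) ≤ vZW G w ρ β 0) :
    2 * β * ∫ ω, Real.exp (-β * vecGradFormW G w ω ω) * vecGradFormW G w ω h ^ 2
        ∂(Measure.pi fun _ : V => ρ) ≤
      vecGradFormW G w h h * ∫ ω, Real.exp (-β * vecGradFormW G w ω ω)
        ∂(Measure.pi fun _ : V => ρ) := by
  set μ₀ : Measure (V → Fin ν → ℝ) := Measure.pi fun _ : V => ρ with hμ₀
  set wt : (V → Fin ν → ℝ) → ℝ := fun ω => Real.exp (-β * vecGradFormW G w ω ω) with hwt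
  set A : (V → Fin ν → ℝ) → ℝ := fun ω => vecGradFormW G w ω h with hA
  set B : ℝ := vecGradFormW G w h h with hB
  set Z₀ : ℝ := ∫ ω, wt ω ∂μ₀ with hZ₀
  set S : ℝ := ∫ ω, wt ω * A ω ^ 2 ∂μ₀ with hS
  show 2 * β * S ≤ B * Z₀
  have hwc : Continuous wt := ((continuous_vecGradFormW_self (G := G) w).const_mul (-β)).rexp
  have hAc : Continuous A := continuous_vecGradFormW_left (G := G) w h
  have hint : ∀ {f : (V → Fin ν → ℝ) → ℝ}, Continuous f → Integrable f μ₀ := fun hf =>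
    integrable_pi_of_continuous ρ hKc hK hf
  have hw_pos : ∀ ω, 0 < wt ω := fun ω => Real.exp_pos _
  have hZ₀_pos : 0 < Z₀ := by
    have := vZW_pos (G := G) hρ hw hβ.le (0 : V → Fin ν → ℝ)
    rwa [vZW_zero] at this
  have hS0 : 0 ≤ S := integral_nonneg fun ω => mul_nonneg (hw_pos ω).le (sq_nonneg _)
  have hB0 : 0 ≤ B := vecGradFormW_self_nonneg hw h
  have hZ0 : vZW G w ρ β 0 = Z₀ := vZW_zero ρ β
  have hlow : ∀ t : ℝ, Real.exp (-β * t ^ 2 * B) * (2 * Z₀ + 4 * β ^ 2 * t ^ 2 * S) ≤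
      vZW G w ρ β (t • h) + vZW G w ρ β ((-t) • h) := by
    intro t
    rw [vZW_smul, vZW_smul, show (-t) ^ 2 = t ^ 2 by ring, ← mul_add]
    refine mul_le_mul_of_nonneg_left ?_ (Real.exp_pos _).le
    have hi1 : Integrable (fun ω => wt ω * Real.exp (-2 * β * t * A ω)) μ₀ := hint (by fun_prop)
    have hi2 : Integrable (fun ω => wt ω * Real.exp (-2 * β * -t * A ω)) μ₀ := hint (by fun_prop)
    have hi3 : Integrable (fun ω => wt ω * (2 + (2 * β * t * A ω) ^ 2)) μ₀ := hint (by fun_prop)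
    rw [← integral_add hi1 hi2]
    calc 2 * Z₀ + 4 * β ^ 2 * t ^ 2 * S = ∫ ω, wt ω * (2 + (2 * β * t * A ω) ^ 2) ∂μ₀ := by
          rw [hZ₀, hS, ← integral_const_mul, ← integral_const_mul, ← integral_add
            ((hint hwc).const_mul _) ((hint (by fun_prop)).const_mul _)]
          refine integral_congr_ae (ae_of_all _ fun ω => ?_)
          simp only
          ring
      _ ≤ ∫ ω, wt ω * Real.exp (-2 * β * t * A ω) + wt ω * Real.exp (-2 * β * -t * A ω) ∂μ₀ := by
          refine integral_mono hi3 (hi1.add hi2) fun ω => ?_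
          simp only
          rw [← mul_add]
          refine mul_le_mul_of_nonneg_left ?_ (hw_pos ω).le
          have e1 : -2 * β * t * A ω = -(2 * β * t * A ω) := by ring
          have e2 : -2 * β * -t * A ω = 2 * β * t * A ω := by ring
          rw [e1, e2, add_comm (Real.exp _)]
          exact two_add_sq_le_exp_add_exp_neg _
  have hphi : ∀ u : ℝ, 0 ≤ u → Z₀ + 2 * β ^ 2 * S * u ≤ Z₀ * Real.exp (β * B * u) := by
    intro u hu
    have h1 := (hlow (Real.sqrt u)).trans (add_le_add (hGD _) (hGD _))
    rw [Real.sq_sqrt hu, hZ0] at h1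
    have hexp : Real.exp (-β * u * B) * Real.exp (β * B * u) = 1 := by
      rw [← Real.exp_add]; convert Real.exp_zero using 2; ring
    have h2 := mul_le_mul_of_nonneg_right h1 (Real.exp_pos (β * B * u)).le
    have h3 : Real.exp (-β * u * B) * (2 * Z₀ + 4 * β ^ 2 * u * S) * Real.exp (β * B * u) =
        2 * (Z₀ + 2 * β ^ 2 * S * u) := by
      calc Real.exp (-β * u * B) * (2 * Z₀ + 4 * β ^ 2 * u * S) * Real.exp (β * B * u)
          = (2 * Z₀ + 4 * β ^ 2 * u * S) * (Real.exp (-β * u * B) * Real.exp (β * B * u)) := by ring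
        _ = 2 * (Z₀ + 2 * β ^ 2 * S * u) := by rw [hexp]; ring
    rw [h3] at h2
    linarith
  by_contra hcon
  push Not at hcon
  set c : ℝ := β * B with hc
  have hlt : Z₀ * c < 2 * β ^ 2 * S := by
    rw [hc]; nlinarith
  have hderiv : HasDerivAt (fun u : ℝ => Z₀ * Real.exp (c * u)) (Z₀ * c) 0 := by
    have h1 : HasDerivAt (fun u : ℝ => c * u) c 0 := by
      simpa using (hasDerivAt_id (0 : ℝ)).const_mul c
    have h2 := (Real.hasDerivAt_exp (c * 0)).comp 0 h1
    simp only [mul_zero, Real.exp_zero, one_mul] at h2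
    simpa using h2.const_mul Z₀
  rw [hasDerivAt_iff_tendsto_slope_zero] at hderiv
  have hev : ∀ᶠ u : ℝ in 𝓝[>] 0, u⁻¹ * (Z₀ * Real.exp (c * u) - Z₀) < 2 * β ^ 2 * S := by
    have ht := hderiv.mono_left (nhdsGT_le_nhdsNE 0)
    simp only [zero_add, mul_zero, Real.exp_zero, mul_one, smul_eq_mul] at ht
    exact ht.eventually (gt_mem_nhds hlt)
  obtain ⟨u, hu, hupos⟩ := (hev.and self_mem_nhdsWithin).exists
  have hupos' : (0 : ℝ) < u := hupos
  have h3 := hphi u hupos'.le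
  have h4 : Z₀ * Real.exp (c * u) - Z₀ < 2 * β ^ 2 * S * u := by
    have := (inv_mul_lt_iff₀ hupos').1 hu
    linarith
  rw [hc] at h4
  have : β * B * u = (β * B) * u := by ring
  rw [this] at h3
  linarith

end SecondOrder

/-! ### Plane waves on the torus with direction weights -/

section PlaneWaves

open _root_.Complex
open scoped ComplexConjugate

variable {d L : ℕ} [NeZero L]

/-- The **anisotropic dispersion** `ε_K(p) = ∑ᵢ K_i (1 − cos pᵢ)` — Fröhlich–Israel–Lieb–Simon's
`E_p` for nearest-neighbour couplings with one constant per direction; Kennedy–Lieb–Shastry's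
`E^r_q = 2 − cos q₁ − cos q₂ + r(1 − cos q₃)` for `K = (1, 1, r)`.
[cite: KLS1988JSP, eq. (7)] [cite: FILS1978, Thm. 4.6/4.7 (E_p)] -/
def anisoDispersion (K : Fin d → ℝ) (p : Fin d → ℝ) : ℝ :=
  ∑ i, K i * (1 - Real.cos (p i))

/-- `ε_K ≥ 0` for `K ≥ 0`. [folklore] -/
private theorem anisoDispersion_nonneg {K : Fin d → ℝ} (hK : ∀ i, 0 ≤ K i) (p : Fin d → ℝ) :
    0 ≤ anisoDispersion K p :=
  Finset.sum_nonneg fun i _ => mul_nonneg (hK i) (sub_nonneg.2 (Real.cos_le_one _))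

/-- `ε_K(p) ≥ (min K) ε(p)`: with `0 < m ≤ K_i` the anisotropic dispersion dominates `m` times the
isotropic one. [folklore] -/
private theorem mul_dispersion_le_anisoDispersion {K : Fin d → ℝ} {m : ℝ} (hK : ∀ i, m ≤ K i)
    (p : Fin d → ℝ) : m * dispersion p ≤ anisoDispersion K p := by
  unfold dispersion anisoDispersion
  rw [Finset.mul_sum]
  exact Finset.sum_le_sum fun i _ =>
    mul_le_mul_of_nonneg_right (hK i) (sub_nonneg.2 (Real.cos_le_one _))

/-- `ε_K(p_k) > 0` for `k ≠ 0` when all `K_i > 0`. [folklore] -/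
private theorem anisoDispersion_latticeMomentum_pos {K : Fin d → ℝ} (hK : ∀ i, 0 < K i)
    {k : TorusSite d L} (hk : k ≠ 0) : 0 < anisoDispersion K (latticeMomentum L k) := by
  obtain ⟨m, hm, hmK⟩ : ∃ m : ℝ, 0 < m ∧ ∀ i, m ≤ K i := by
    by_cases hd : (Finset.univ : Finset (Fin d)).Nonempty
    · obtain ⟨i₀, -, hi₀⟩ := Finset.exists_min_image Finset.univ K hd
      exact ⟨K i₀, hK i₀, fun i => hi₀ i (Finset.mem_univ i)⟩
    · refine ⟨1, one_pos, fun i => ?_⟩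
      exact absurd ⟨i, Finset.mem_univ i⟩ hd
  have hε : 0 < dispersion (latticeMomentum L k) := lt_of_le_of_ne (dispersion_nonneg _)
    fun h => hk ((dispersion_latticeMomentum_eq_zero_iff_holds k).1 h.symm)
  exact lt_of_lt_of_le (mul_pos hm hε) (mul_dispersion_le_anisoDispersion hmK _)

/-- **`𝓔_K(f, χ_k) = 2ε_K(p_k) ∑_x f_x χ_k(x)`** for a real `f` on the torus, the plane wave `χ_k`
and the direction weights `K` (the proof of Thm. 10.24 with one coupling per direction:
`∑_i K_i ∑_x (f_x − f_{x+eᵢ})(χ_x − χ_{x+eᵢ}) = ∑_i K_i (1 − e^{ipᵢ})(1 − e^{−ipᵢ}) ∑ f χ`), `L ≥ 3`.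
[cite: FriedliVelenik2017, §10.5.3, proof of Thm. 10.24] [cite: FILS1978, Thm. 4.7 (E_p)] -/
theorem gradFormCW_torusChar_fun (hL : 3 ≤ L) (K : Fin d → ℝ) (k : TorusSite d L)
    (f : TorusSite d L → ℝ) :
    gradFormCW (torusGraph d L) (dirWeight K) f (torusChar k) =
      ((2 * anisoDispersion K (latticeMomentum L k) : ℝ) : ℂ) * ∑ x, (f x : ℂ) * torusChar k x := by
  classical
  have hL2 : 2 ≤ L := by omega
  unfold gradFormCW
  rw [sum_edgeFinset_torusGraph hL]
  simp only [Sym2.lift_mk, dirWeight_mk_add_single hL]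
  set M : ℂ := ∑ x, (f x : ℂ) * torusChar k x with hM
  set u : Fin d → ℂ := fun i => Complex.exp (latticeMomentum L k i * I) with hu
  have hχ : ∀ x i, torusChar k (x + Pi.single i 1) = torusChar k x * u i := fun x i => by
    rw [torusChar_add_right, torusChar_single hL2]
  have hshift : ∀ i, ∑ x, (f (x + Pi.single i 1) : ℂ) * torusChar k x = conj (u i) * M := by
    intro i
    rw [hM, Finset.mul_sum, ← Equiv.sum_comp (Equiv.addRight (Pi.single i 1))
      (fun x => conj (u i) * ((f x : ℂ) * torusChar k x))]
    refine Finset.sum_congr rfl fun x _ => ?_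
    simp only [Equiv.coe_addRight, hχ]
    have hu1 : conj (u i) * u i = 1 := by
      rw [mul_comm, Complex.mul_conj, hu]
      simp [Complex.normSq_eq_norm_sq, Complex.norm_exp_ofReal_mul_I]
    calc (f (x + Pi.single i 1) : ℂ) * torusChar k x
        = (f (x + Pi.single i 1) : ℂ) * torusChar k x * (conj (u i) * u i) := by rw [hu1, mul_one]
      _ = conj (u i) * ((f (x + Pi.single i 1) : ℂ) * (torusChar k x * u i)) := by ring
  have hterm : ∀ x i, (((f x - f (x + Pi.single i 1) : ℝ)) : ℂ) *
      (torusChar k x - torusChar k (x + Pi.single i 1)) =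
        (1 - u i) * ((f x : ℂ) * torusChar k x) -
          (1 - u i) * ((f (x + Pi.single i 1) : ℂ) * torusChar k x) := by
    intro x i; rw [hχ]; push_cast; ring
  have hi : ∀ i, ∑ x, ((K i : ℝ) : ℂ) * ((((f x - f (x + Pi.single i 1) : ℝ)) : ℂ) *
      (torusChar k x - torusChar k (x + Pi.single i 1))) =
        ((K i : ℝ) : ℂ) * ((1 - u i) * (1 - conj (u i))) * M := by
    intro i
    rw [← Finset.mul_sum, mul_assoc]
    congr 1
    calc ∑ x, (((f x - f (x + Pi.single i 1) : ℝ)) : ℂ) *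
          (torusChar k x - torusChar k (x + Pi.single i 1))
        = ∑ x, ((1 - u i) * ((f x : ℂ) * torusChar k x) -
            (1 - u i) * ((f (x + Pi.single i 1) : ℂ) * torusChar k x)) :=
          Finset.sum_congr rfl fun x _ => hterm x i
      _ = (1 - u i) * ∑ x, (f x : ℂ) * torusChar k x -
            (1 - u i) * ∑ x, (f (x + Pi.single i 1) : ℂ) * torusChar k x := by
          rw [Finset.sum_sub_distrib, Finset.mul_sum, Finset.mul_sum]
      _ = (1 - u i) * M - (1 - u i) * (conj (u i) * M) := by rw [hshift]
      _ = (1 - u i) * (1 - conj (u i)) * M := by ring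
  have hsum : ∑ i, ((K i : ℝ) : ℂ) * ((1 - u i) * (1 - conj (u i))) =
      ((2 * anisoDispersion K (latticeMomentum L k) : ℝ) : ℂ) := by
    unfold anisoDispersion
    push_cast
    rw [Finset.mul_sum]
    refine Finset.sum_congr rfl fun i _ => ?_
    have := one_sub_mul_one_sub_conj_exp (latticeMomentum L k i)
    rw [hu]
    push_cast at this ⊢
    rw [this]
    ring
  rw [Finset.sum_comm]
  calc ∑ i, ∑ x, ((K i : ℝ) : ℂ) * ((((f x - f (x + Pi.single i 1) : ℝ)) : ℂ) *
        (torusChar k x - torusChar k (x + Pi.single i 1)))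
      = ∑ i, ((K i : ℝ) : ℂ) * ((1 - u i) * (1 - conj (u i))) * M :=
        Finset.sum_congr rfl fun i _ => hi i
    _ = (∑ i, ((K i : ℝ) : ℂ) * ((1 - u i) * (1 - conj (u i)))) * M := by rw [Finset.sum_mul]
    _ = ((2 * anisoDispersion K (latticeMomentum L k) : ℝ) : ℂ) * M := by rw [hsum]

/-- **`∑_{(x,i)} K_i ‖χ_k(x) − χ_k(x+eᵢ)‖² = 2 L^d ε_K(p_k)`**, `L ≥ 3`.
[cite: FriedliVelenik2017, §10.5.3, proof of Thm. 10.24] [cite: FILS1978, Thm. 4.7 (E_p)] -/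
theorem gradNormSqW_torusChar (hL : 3 ≤ L) (K : Fin d → ℝ) (k : TorusSite d L) :
    gradNormSqW (torusGraph d L) (dirWeight K) (torusChar k) =
      2 * (L : ℝ) ^ d * anisoDispersion K (latticeMomentum L k) := by
  classical
  have hL2 : 2 ≤ L := by omega
  unfold gradNormSqW
  rw [sum_edgeFinset_torusGraph hL]
  simp only [Sym2.lift_mk, dirWeight_mk_add_single hL]
  have hterm : ∀ (x : TorusSite d L) (i : Fin d),
      ‖torusChar k x - torusChar k (x + Pi.single i 1)‖ ^ 2 =
        2 * (1 - Real.cos (latticeMomentum L k i)) := by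
    intro x i
    rw [torusChar_add_right, torusChar_single hL2, ← mul_one_sub, norm_mul, norm_torusChar,
      one_mul, ← Complex.normSq_eq_norm_sq, normSq_one_sub_exp_mul_I]
  simp_rw [hterm]
  have hinner : ∑ i : Fin d, K i * (2 * (1 - Real.cos (latticeMomentum L k i))) =
      2 * anisoDispersion K (latticeMomentum L k) := by
    unfold anisoDispersion
    rw [Finset.mul_sum]
    exact Finset.sum_congr rfl fun i _ => by ring
  simp_rw [hinner]
  rw [Finset.sum_const, Finset.card_univ, nsmul_eq_mul, Fintype.card_fun, ZMod.card,
    Fintype.card_fin]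
  push_cast
  ring

variable {V : Type*} [Fintype V] {G : SimpleGraph V} [DecidableRel G.Adj] {ν : ℕ} {w : Sym2 V → ℝ}

/-- Real and imaginary parts of the complexified weighted form. [folklore] -/
private theorem gradFormCW_re (f : V → ℝ) (g : V → ℂ) :
    (gradFormCW G w f g).re = gradFormW G w f (fun x => (g x).re) := by
  unfold gradFormCW gradFormW
  rw [Complex.re_sum]
  refine Finset.sum_congr rfl fun e _ => ?_
  induction e using Sym2.ind with
  | _ x y => simp [Complex.mul_re]

/-- Real and imaginary parts of the complexified weighted form. [folklore] -/
private theorem gradFormCW_im (f : V → ℝ) (g : V → ℂ) :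
    (gradFormCW G w f g).im = gradFormW G w f (fun x => (g x).im) := by
  unfold gradFormCW gradFormW
  rw [Complex.im_sum]
  refine Finset.sum_congr rfl fun e _ => ?_
  induction e using Sym2.ind with
  | _ x y => simp [Complex.mul_im]

/-- `∑ w_e‖g_x − g_y‖² = 𝓔_w(Re g, Re g) + 𝓔_w(Im g, Im g)`. [folklore] -/
private theorem gradNormSqW_eq (g : V → ℂ) :
    gradNormSqW G w g = gradFormW G w (fun x => (g x).re) (fun x => (g x).re) +
      gradFormW G w (fun x => (g x).im) (fun x => (g x).im) := by
  unfold gradNormSqW gradFormW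
  rw [← Finset.sum_add_distrib]
  refine Finset.sum_congr rfl fun e _ => ?_
  induction e using Sym2.ind with
  | _ x y =>
    simp only [Sym2.lift_mk]
    rw [Complex.sq_norm, Complex.normSq_apply, Complex.sub_re, Complex.sub_im]
    ring

/-- `𝓔_w(f, r e_a) = 𝓔_w(f^a, r)`. [folklore] -/
private theorem vecGradFormW_planeField_right (f : V → Fin ν → ℝ) (a : Fin ν) (r : V → ℝ) :
    vecGradFormW G w f (planeField a r) = gradFormW G w (fun x => f x a) r := by
  unfold vecGradFormW gradFormW
  refine Finset.sum_congr rfl fun e _ => ?_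
  induction e using Sym2.ind with
  | _ x y =>
    simp only [Sym2.lift_mk]
    congr 1
    rw [Finset.sum_eq_single a (fun b _ hb => ?_) (fun ha => absurd (Finset.mem_univ a) ha)]
    · simp only [planeField, if_true]
    · simp only [planeField, if_neg hb, sub_self, mul_zero]

/-- `𝓔_w(r e_a, r e_a) = 𝓔_w(r, r)`. [folklore] -/
private theorem vecGradFormW_planeField_self (a : Fin ν) (r : V → ℝ) :
    vecGradFormW G w (planeField a r) (planeField a r) = gradFormW G w r r := by
  rw [vecGradFormW_planeField_right]
  simp only [planeField, if_true]

/-- **The anisotropic infrared bound per spin component, weighted form**: with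
`wt(ω) = e^{−β𝓔_K(ω,ω)}`, `4βε_K(p_k) ∫ wt(ω)|∑_x ω_x^a χ_k(x)|² dμ₀ ≤ L^d ∫ wt dμ₀` (the proof of
Thm. 10.24 for the real and imaginary parts of `χ_k e_a`, with `𝓔_K(ω, χ_k e_a) = 2ε_K Ŝ^a_k` and
`∑_{(x,i)} K_i‖χ_k(x+eᵢ) − χ_k(x)‖² = 2L^dε_K`).
[cite: FriedliVelenik2017, Thm. 10.24, proof pp. 506–507] [cite: FILS1978, Thm. 4.7] -/
theorem weighted_mode_boundW (hL : Even L) (hL4 : 4 ≤ L) (ρ : Measure (Fin ν → ℝ))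
    [IsFiniteMeasure ρ] {K₀ : Set (Fin ν → ℝ)} (hKc : IsCompact K₀) (hK : ρ K₀ᶜ = 0) (hρ : ρ ≠ 0)
    {β : ℝ} (hβ : 0 < β) {K : Fin d → ℝ} (hKn : ∀ i, 0 ≤ K i) (k : TorusSite d L)
    (hε : 0 < anisoDispersion K (latticeMomentum L k)) (a : Fin ν) :
    4 * β * anisoDispersion K (latticeMomentum L k) *
        ∫ ω, Real.exp (-β * vecGradFormW (torusGraph d L) (dirWeight K) ω ω) *
          ‖∑ x, (ω x a : ℂ) * torusChar k x‖ ^ 2 ∂(Measure.pi fun _ : TorusSite d L => ρ) ≤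
      (L : ℝ) ^ d * ∫ ω, Real.exp (-β * vecGradFormW (torusGraph d L) (dirWeight K) ω ω)
        ∂(Measure.pi fun _ : TorusSite d L => ρ) := by
  set Gr := torusGraph d L with hGr
  set w : Sym2 (TorusSite d L) → ℝ := dirWeight K with hwdef
  have hw0 : ∀ e, 0 ≤ w e := dirWeight_nonneg hKn
  set μ₀ : Measure (TorusSite d L → Fin ν → ℝ) := Measure.pi fun _ : TorusSite d L => ρ with hμ₀
  have hL3 : 3 ≤ L := by omega
  set ε : ℝ := anisoDispersion K (latticeMomentum L k) with hε'
  set h₁ : TorusSite d L → Fin ν → ℝ := planeField a (fun x => (torusChar k x).re) with hh₁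
  set h₂ : TorusSite d L → Fin ν → ℝ := planeField a (fun x => (torusChar k x).im) with hh₂
  set wt : (TorusSite d L → Fin ν → ℝ) → ℝ := fun ω => Real.exp (-β * vecGradFormW Gr w ω ω)
    with hwt
  set A₁ : (TorusSite d L → Fin ν → ℝ) → ℝ := fun ω => vecGradFormW Gr w ω h₁ with hA₁
  set A₂ : (TorusSite d L → Fin ν → ℝ) → ℝ := fun ω => vecGradFormW Gr w ω h₂ with hA₂
  set M : (TorusSite d L → Fin ν → ℝ) → ℂ := fun ω => ∑ x, (ω x a : ℂ) * torusChar k x with hM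
  set Z₀ : ℝ := ∫ ω, wt ω ∂μ₀ with hZ₀
  set X : ℝ := ∫ ω, wt ω * ‖M ω‖ ^ 2 ∂μ₀ with hX
  show 4 * β * ε * X ≤ (L : ℝ) ^ d * Z₀
  have hGD : ∀ (h : TorusSite d L → Fin ν → ℝ) (t : ℝ), vZW Gr w ρ β (t • h) ≤ vZW Gr w ρ β 0 :=
    fun h t => vZW_le_vZW_zero hL hL4 ρ hKc hK hρ hβ.le hKn _
  have key₁ : 2 * β * ∫ ω, wt ω * A₁ ω ^ 2 ∂μ₀ ≤ vecGradFormW Gr w h₁ h₁ * Z₀ :=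
    integral_weight_vecGradFormW_sq_le (G := Gr) ρ hKc hK hρ hw0 hβ h₁ (hGD h₁)
  have key₂ : 2 * β * ∫ ω, wt ω * A₂ ω ^ 2 ∂μ₀ ≤ vecGradFormW Gr w h₂ h₂ * Z₀ :=
    integral_weight_vecGradFormW_sq_le (G := Gr) ρ hKc hK hρ hw0 hβ h₂ (hGD h₂)
  have hA : ∀ ω, A₁ ω ^ 2 + A₂ ω ^ 2 = 4 * ε ^ 2 * ‖M ω‖ ^ 2 := by
    intro ω
    have hC := gradFormCW_torusChar_fun hL3 K k (fun x => ω x a)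
    have hre : A₁ ω = 2 * ε * (M ω).re := by
      rw [hA₁, hM]
      simp only
      rw [hh₁, vecGradFormW_planeField_right, ← gradFormCW_re, hwdef, hC, Complex.re_ofReal_mul]
    have him : A₂ ω = 2 * ε * (M ω).im := by
      rw [hA₂, hM]
      simp only
      rw [hh₂, vecGradFormW_planeField_right, ← gradFormCW_im, hwdef, hC, Complex.im_ofReal_mul]
    rw [hre, him, ← Complex.normSq_eq_norm_sq, Complex.normSq_apply]
    ring
  have hB : vecGradFormW Gr w h₁ h₁ + vecGradFormW Gr w h₂ h₂ = 2 * (L : ℝ) ^ d * ε := by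
    rw [hh₁, hh₂, vecGradFormW_planeField_self, vecGradFormW_planeField_self, ← gradNormSqW_eq,
      hwdef, gradNormSqW_torusChar hL3]
  have hwc : Continuous wt := ((continuous_vecGradFormW_self (G := Gr) w).const_mul (-β)).rexp
  have hA₁c : Continuous A₁ := continuous_vecGradFormW_left (G := Gr) w h₁
  have hA₂c : Continuous A₂ := continuous_vecGradFormW_left (G := Gr) w h₂
  have hMc : Continuous M := by rw [hM]; fun_prop
  have hint : ∀ {f : (TorusSite d L → Fin ν → ℝ) → ℝ}, Continuous f → Integrable f μ₀ := fun hf =>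
    integrable_pi_of_continuous ρ hKc hK hf
  have hS : ∫ ω, wt ω * A₁ ω ^ 2 ∂μ₀ + ∫ ω, wt ω * A₂ ω ^ 2 ∂μ₀ = 4 * ε ^ 2 * X := by
    rw [hX, ← integral_add (hint (by fun_prop)) (hint (by fun_prop)), ← integral_const_mul]
    refine integral_congr_ae (ae_of_all _ fun ω => ?_)
    simp only
    rw [← mul_add, hA ω]
    ring
  have hsum : 2 * β * (4 * ε ^ 2 * X) ≤ 2 * (L : ℝ) ^ d * ε * Z₀ := by
    calc 2 * β * (4 * ε ^ 2 * X)
        = 2 * β * ∫ ω, wt ω * A₁ ω ^ 2 ∂μ₀ + 2 * β * ∫ ω, wt ω * A₂ ω ^ 2 ∂μ₀ := by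
          rw [← hS, mul_add]
      _ ≤ vecGradFormW Gr w h₁ h₁ * Z₀ + vecGradFormW Gr w h₂ h₂ * Z₀ := add_le_add key₁ key₂
      _ = 2 * (L : ℝ) ^ d * ε * Z₀ := by rw [← add_mul, hB]
  have h8 : ε * (4 * β * ε * X) ≤ ε * ((L : ℝ) ^ d * Z₀) := by nlinarith
  exact le_of_mul_le_mul_left h8 hε

end PlaneWaves

/-! ### The torus model with direction-dependent couplings: Hamiltonian, Gibbs measure, the theorems -/

section TorusModel

open scoped ComplexConjugate

variable {d L ν : ℕ}

/-- **The `ν`-vector Hamiltonian with one coupling per direction**: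
`ℋ_{β,K}(ω) = β ∑_x ∑_i K_i ‖ω(x + eᵢ) − ω(x)‖²` on `(ℤ/Lℤ)^d` (`K ≡ 1` is (10.38); `d = 3`,
`K = (J∥, J∥, J⊥)` the layered model). [cite: FILS1978, §3 (C) and Thm. 4.6 (nearest-neighbour J with direction-dependent strengths)] -/
def anisoHamiltonian [NeZero L] (β : ℝ) (K : Fin d → ℝ) (ω : VecConfig d L ν) : ℝ :=
  β * ∑ x : TorusSite d L, ∑ i : Fin d, K i * ∑ a : Fin ν, (ω (x + Pi.single i 1) a - ω x a) ^ 2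

/-- The anisotropic Hamiltonian is nonnegative for `β ≥ 0`, `K ≥ 0`. [cite: FILS1978, Thm. 4.6 (the Hamiltonian H)] -/
theorem anisoHamiltonian_nonneg [NeZero L] {β : ℝ} (hβ : 0 ≤ β) {K : Fin d → ℝ}
    (hK : ∀ i, 0 ≤ K i) (ω : VecConfig d L ν) : 0 ≤ anisoHamiltonian β K ω :=
  mul_nonneg hβ (Finset.sum_nonneg fun _ _ => Finset.sum_nonneg fun i _ =>
    mul_nonneg (hK i) (Finset.sum_nonneg fun _ _ => sq_nonneg _))

/-- The anisotropic Hamiltonian is continuous. [cite: FILS1978, Thm. 4.6 (the Hamiltonian H)] -/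
theorem continuous_anisoHamiltonian [NeZero L] (β : ℝ) (K : Fin d → ℝ) :
    Continuous fun ω : VecConfig d L ν => anisoHamiltonian β K ω := by
  unfold anisoHamiltonian
  fun_prop

/-- The partition function `Z_{β,K} = ∫ e^{−ℋ_{β,K}} dμ₀`. [cite: FILS1978, Thm. 4.6] -/
def anisoPartitionFunction [NeZero L] (ρ : Measure (Fin ν → ℝ)) (β : ℝ) (K : Fin d → ℝ) : ℝ :=
  ∫ ω, Real.exp (-anisoHamiltonian β K ω) ∂(nVectorRef (d := d) (L := L) ρ)

/-- The **Gibbs distribution** `Z⁻¹ e^{−ℋ_{β,K}} μ₀` of the `ν`-vector model with direction-dependent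
couplings on the torus. [cite: FILS1978, Thm. 4.6] -/
def anisoGibbs [NeZero L] (ρ : Measure (Fin ν → ℝ)) (β : ℝ) (K : Fin d → ℝ) :
    Measure (VecConfig d L ν) :=
  (ENNReal.ofReal (anisoPartitionFunction (d := d) (L := L) ρ β K))⁻¹ •
    (nVectorRef (d := d) (L := L) ρ).withDensity
      fun ω => ENNReal.ofReal (Real.exp (-anisoHamiltonian β K ω))

variable [NeZero L]

/-- The Boltzmann weight is integrable (`β, K ≥ 0`, finite `ρ`). [cite: FILS1978, Thm. 4.6 (Z)] -/
theorem integrable_exp_neg_anisoHamiltonian (ρ : Measure (Fin ν → ℝ)) [IsFiniteMeasure ρ]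
    {β : ℝ} (hβ : 0 ≤ β) {K : Fin d → ℝ} (hK : ∀ i, 0 ≤ K i) :
    Integrable (fun ω : VecConfig d L ν => Real.exp (-anisoHamiltonian β K ω))
      (nVectorRef (d := d) (L := L) ρ) := by
  refine (integrable_const (1 : ℝ)).mono'
    (continuous_anisoHamiltonian β K).neg.rexp.aestronglyMeasurable (ae_of_all _ fun ω => ?_)
  rw [Real.norm_eq_abs, abs_of_pos (Real.exp_pos _), Real.exp_le_one_iff, neg_nonpos]
  exact anisoHamiltonian_nonneg hβ hK ω

/-- `Z_{β,K} > 0` for a nonzero finite single-spin measure. [cite: FILS1978, Thm. 4.6 (Z)] -/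
theorem anisoPartitionFunction_pos (ρ : Measure (Fin ν → ℝ)) [IsFiniteMeasure ρ] (hρ : ρ ≠ 0)
    {β : ℝ} (hβ : 0 ≤ β) {K : Fin d → ℝ} (hK : ∀ i, 0 ≤ K i) :
    0 < anisoPartitionFunction (d := d) (L := L) ρ β K := by
  unfold anisoPartitionFunction nVectorRef
  haveI : NeZero (Measure.pi fun _ : TorusSite d L => ρ) := ⟨pi_ne_zero ρ hρ⟩
  exact integral_exp_pos (integrable_exp_neg_anisoHamiltonian ρ hβ hK)

/-- The Hamiltonian is `β` times the weighted bond form of the torus graph with the direction weight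
(`L ≥ 3`). [cite: FILS1978, Thm. 4.6 (the Hamiltonian H)] -/
theorem anisoHamiltonian_eq_vecGradFormW (hL : 3 ≤ L) (β : ℝ) (K : Fin d → ℝ) (ω : VecConfig d L ν) :
    anisoHamiltonian β K ω = β * vecGradFormW (torusGraph d L) (dirWeight K) ω ω := by
  unfold anisoHamiltonian vecGradFormW
  rw [sum_edgeFinset_torusGraph hL]
  congr 1
  refine Finset.sum_congr rfl fun x _ => Finset.sum_congr rfl fun i _ => ?_
  simp only [Sym2.lift_mk, dirWeight_mk_add_single hL]
  congr 1
  exact Finset.sum_congr rfl fun a _ => by ring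

/-- **Gibbs expectations as weighted `μ₀`-averages**: `⟨F⟩_{β,K} = Z⁻¹ ∫ e^{−ℋ(ω)} F(ω) dμ₀(ω)`.
[cite: FriedliVelenik2017, §10.5.1] -/
theorem integral_anisoGibbs (ρ : Measure (Fin ν → ℝ)) [IsFiniteMeasure ρ] (hρ : ρ ≠ 0)
    {β : ℝ} (hβ : 0 ≤ β) {K : Fin d → ℝ} (hK : ∀ i, 0 ≤ K i) (F : VecConfig d L ν → ℝ) :
    ∫ ω, F ω ∂(anisoGibbs (d := d) (L := L) ρ β K) =
      (∫ ω, Real.exp (-anisoHamiltonian β K ω) * F ω ∂(nVectorRef (d := d) (L := L) ρ)) /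
        anisoPartitionFunction (d := d) (L := L) ρ β K := by
  have hZ := anisoPartitionFunction_pos (d := d) (L := L) ρ hρ hβ hK
  have hmeas : Measurable fun ω : VecConfig d L ν =>
      ENNReal.ofReal (Real.exp (-anisoHamiltonian β K ω)) :=
    ((continuous_anisoHamiltonian β K).neg.rexp).measurable.ennreal_ofReal
  rw [anisoGibbs, integral_smul_measure, integral_withDensity_eq_integral_toReal_smul hmeas
      (ae_of_all _ fun _ => ENNReal.ofReal_lt_top)]
  simp_rw [ENNReal.toReal_ofReal (Real.exp_pos _).le, smul_eq_mul]
  rw [ENNReal.toReal_inv, ENNReal.toReal_ofReal hZ.le, div_eq_inv_mul]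

/-- **The infrared bound for `ν`-vector models with direction-dependent nearest-neighbour couplings**
(Fröhlich–Israel–Lieb–Simon 1978, Thm. 4.7 `g(p) ≤ (2βE_p)⁻¹` with the anisotropic `E_p`; proof of
Friedli–Velenik's Thm. 10.24 with a weight per direction): on the torus `(ℤ/Lℤ)^d`, `L` even,
`L ≥ 4`, for a nonzero finite compactly supported single-spin measure `ρ`, `β > 0`, couplings
`K_i > 0`, and every `k ≠ 0` (`p = 2πk/L`),
`|𝕋_L|⁻¹ ⟨‖∑_x e^{−ip·x} S_x‖₂²⟩_{β,K} ≤ ν / (4β ε_K(p))`, `ε_K(p) = ∑ᵢ K_i(1 − cos pᵢ)`.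
[cite: FILS1978, Thm. 4.7 with §3 (C)] [cite: FriedliVelenik2017, Thm. 10.24] -/
theorem aniso_infraredBound (hL : Even L) (hL4 : 4 ≤ L) (ρ : Measure (Fin ν → ℝ))
    [IsFiniteMeasure ρ] (hKex : ∃ K₀ : Set (Fin ν → ℝ), IsCompact K₀ ∧ ρ K₀ᶜ = 0) (hρ : ρ ≠ 0)
    {β : ℝ} (hβ : 0 < β) {K : Fin d → ℝ} (hKpos : ∀ i, 0 < K i) (k : TorusSite d L)
    (hk : k ≠ 0) :
    (1 / (L : ℝ) ^ d) * ∫ ω, spinFourierNormSq ω k ∂(anisoGibbs (d := d) (L := L) ρ β K) ≤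
      ν / (4 * β * anisoDispersion K (latticeMomentum L k)) := by
  obtain ⟨K₀, hKc, hK⟩ := hKex
  have hKn : ∀ i, 0 ≤ K i := fun i => (hKpos i).le
  have hL3 : 3 ≤ L := by omega
  have hL0 : (0 : ℝ) < (L : ℝ) ^ d := pow_pos (Nat.cast_pos.2 (Nat.pos_of_ne_zero (NeZero.ne L))) d
  set μ₀ : Measure (VecConfig d L ν) := nVectorRef (d := d) (L := L) ρ with hμ₀def
  have hμ₀pi : μ₀ = Measure.pi fun _ : TorusSite d L => ρ := rfl
  set Z : ℝ := anisoPartitionFunction (d := d) (L := L) ρ β K with hZdef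
  have hZpos : 0 < Z := anisoPartitionFunction_pos (d := d) (L := L) ρ hρ hβ.le hKn
  set wt : VecConfig d L ν → ℝ := fun ω => Real.exp (-anisoHamiltonian β K ω) with hwt
  have hw_eq : ∀ ω, wt ω = Real.exp (-β * vecGradFormW (torusGraph d L) (dirWeight K) ω ω) :=
    fun ω => by
    rw [hwt]
    simp only
    rw [anisoHamiltonian_eq_vecGradFormW hL3, neg_mul]
  have hZ_eq : Z = ∫ ω, wt ω ∂μ₀ := rfl
  have hwc : Continuous wt := (continuous_anisoHamiltonian β K).neg.rexp
  have hint : ∀ {f : VecConfig d L ν → ℝ}, Continuous f → Integrable f μ₀ := fun hf =>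
    integrable_pi_of_continuous ρ hKc hK hf
  set ε := anisoDispersion K (latticeMomentum L k) with hε
  have hεpos : 0 < ε := anisoDispersion_latticeMomentum_pos hKpos hk
  have hcomp : ∀ a : Fin ν, 4 * β * ε *
      ∫ ω, wt ω * ‖torusFourier (fun x => (ω x a : ℂ)) k‖ ^ 2 ∂μ₀ ≤ (L : ℝ) ^ d * Z := by
    intro a
    have h := weighted_mode_boundW hL hL4 ρ hKc hK hρ hβ hKn k hεpos a
    rw [hZ_eq, hμ₀pi]
    simp_rw [hw_eq, ← norm_sum_mul_torusChar]
    exact h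
  have hsum : 4 * β * ε * ∫ ω, wt ω * spinFourierNormSq ω k ∂μ₀ ≤ ν * ((L : ℝ) ^ d * Z) := by
    have hsplit : ∫ ω, wt ω * spinFourierNormSq ω k ∂μ₀ =
        ∑ a : Fin ν, ∫ ω, wt ω * ‖torusFourier (fun x => (ω x a : ℂ)) k‖ ^ 2 ∂μ₀ := by
      unfold spinFourierNormSq
      simp_rw [Finset.mul_sum]
      rw [integral_finsetSum _ fun a _ => hint (by fun_prop)]
    rw [hsplit, Finset.mul_sum]
    calc ∑ a : Fin ν, 4 * β * ε * ∫ ω, wt ω * ‖torusFourier (fun x => (ω x a : ℂ)) k‖ ^ 2 ∂μ₀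
        ≤ ∑ _a : Fin ν, (L : ℝ) ^ d * Z := Finset.sum_le_sum fun a _ => hcomp a
      _ = ν * ((L : ℝ) ^ d * Z) := by
          rw [Finset.sum_const, Finset.card_univ, Fintype.card_fin, nsmul_eq_mul]
  have hfin : (1 / (L : ℝ) ^ d) * ((∫ ω, wt ω * spinFourierNormSq ω k ∂μ₀) / Z) ≤
      ν / (4 * β * ε) := by
    rw [div_mul_div_comm, one_mul, div_le_div_iff₀ (by positivity) (by positivity)]
    linarith [hsum]
  rw [integral_anisoGibbs ρ hρ hβ.le hKn]
  exact hfin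

/-- **Finite-volume long-range-order bound with direction-dependent couplings** (Friedli–Velenik's
display after Thm. 10.24 / FILS (4.10), with the anisotropic dispersion): for unit spins
(`‖S‖₂ = 1` `ρ`-a.s.), `L` even, `L ≥ 4`, `β > 0`, `K_i > 0`,
`⟨‖m_L‖₂²⟩_{β,K} ≥ 1 − (ν/4β) |𝕋_L|⁻¹ ∑_{k≠0} ε_K(2πk/L)⁻¹`. For `d = 3`, `K = (1,1,r)` the sum is
Kennedy–Lieb–Shastry's `|Λ|⁻¹∑_{q≠0} 1/E^r_q`.
[cite: FILS1978, (4.6)–(4.10) with Thm. 4.7] [cite: FriedliVelenik2017, Thm. 10.24 and §10.5.2 (10.39)–(10.40)] -/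
theorem aniso_longRangeOrderBound (hL : Even L) (hL4 : 4 ≤ L) (ρ : Measure (Fin ν → ℝ))
    [IsFiniteMeasure ρ] (hKex : ∃ K₀ : Set (Fin ν → ℝ), IsCompact K₀ ∧ ρ K₀ᶜ = 0) (hρ : ρ ≠ 0)
    {β : ℝ} (hβ : 0 < β) {K : Fin d → ℝ} (hKpos : ∀ i, 0 < K i)
    (hnorm : ∀ᵐ s ∂ρ, ∑ a, s a ^ 2 = 1) :
    1 - ν / (4 * β) * ((1 / (L : ℝ) ^ d) *
        ∑ k ∈ Finset.univ.erase (0 : TorusSite d L), 1 / anisoDispersion K (latticeMomentum L k)) ≤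
      ∫ ω, magnetisationNormSq ω ∂(anisoGibbs (d := d) (L := L) ρ β K) := by
  obtain ⟨K₀, hKc, hK⟩ := hKex
  have hKn : ∀ i, 0 ≤ K i := fun i => (hKpos i).le
  have hL0 : (0 : ℝ) < (L : ℝ) ^ d := pow_pos (Nat.cast_pos.2 (Nat.pos_of_ne_zero (NeZero.ne L))) d
  set μ₀ : Measure (VecConfig d L ν) := nVectorRef (d := d) (L := L) ρ with hμ₀def
  have hμ₀pi : μ₀ = Measure.pi fun _ : TorusSite d L => ρ := rfl
  set Z : ℝ := anisoPartitionFunction (d := d) (L := L) ρ β K with hZdef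
  have hZpos : 0 < Z := anisoPartitionFunction_pos (d := d) (L := L) ρ hρ hβ.le hKn
  set wt : VecConfig d L ν → ℝ := fun ω => Real.exp (-anisoHamiltonian β K ω) with hwt
  have hZ_eq : Z = ∫ ω, wt ω ∂μ₀ := rfl
  have hwc : Continuous wt := (continuous_anisoHamiltonian β K).neg.rexp
  have hint : ∀ {f : VecConfig d L ν → ℝ}, Continuous f → Integrable f μ₀ := fun hf =>
    integrable_pi_of_continuous ρ hKc hK hf
  -- clause (1) in weighted form
  have clause1 : ∀ k : TorusSite d L, k ≠ 0 →
      (1 / (L : ℝ) ^ d) * ((∫ ω, wt ω * spinFourierNormSq ω k ∂μ₀) / Z) ≤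
        ν / (4 * β * anisoDispersion K (latticeMomentum L k)) := by
    intro k hk
    have h := aniso_infraredBound hL hL4 ρ ⟨K₀, hKc, hK⟩ hρ hβ hKpos k hk
    rwa [integral_anisoGibbs ρ hρ hβ.le hKn] at h
  have hae : ∀ᵐ ω ∂μ₀, ∀ x, ∑ a, ω x a ^ 2 = 1 := ae_pi_forall (ι := TorusSite d L) ρ hnorm
  have hmag : ∫ ω, wt ω * magnetisationNormSq ω ∂μ₀ =
      Z - (1 / (L : ℝ) ^ d) ^ 2 * ∑ k ∈ Finset.univ.erase (0 : TorusSite d L),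
        ∫ ω, wt ω * spinFourierNormSq ω k ∂μ₀ := by
    have h1 : ∫ ω, wt ω * magnetisationNormSq ω ∂μ₀ =
        ∫ ω, (wt ω - (1 / (L : ℝ) ^ d) ^ 2 * ∑ k ∈ Finset.univ.erase (0 : TorusSite d L),
          wt ω * spinFourierNormSq ω k) ∂μ₀ := by
      refine integral_congr_ae ?_
      filter_upwards [hae] with ω hω
      rw [magnetisationNormSq_eq ω hω, mul_sub, mul_one, Finset.mul_sum, Finset.mul_sum,
        Finset.mul_sum]
      congr 1
      exact Finset.sum_congr rfl fun k _ => by ring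
    have h2 : Integrable (fun ω => (1 / (L : ℝ) ^ d) ^ 2 *
        ∑ k ∈ Finset.univ.erase (0 : TorusSite d L), wt ω * spinFourierNormSq ω k) μ₀ :=
      hint (by fun_prop)
    rw [h1, integral_sub (hint (by fun_prop)) h2, integral_const_mul,
      integral_finsetSum _ fun k _ => hint (by fun_prop), hZ_eq]
  have hbound : ∑ k ∈ Finset.univ.erase (0 : TorusSite d L),
      (1 / (L : ℝ) ^ d) ^ 2 * (∫ ω, wt ω * spinFourierNormSq ω k ∂μ₀) / Z ≤
        ν / (4 * β) * ((1 / (L : ℝ) ^ d) *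
          ∑ k ∈ Finset.univ.erase (0 : TorusSite d L),
            1 / anisoDispersion K (latticeMomentum L k)) := by
    rw [Finset.mul_sum, Finset.mul_sum]
    refine Finset.sum_le_sum fun k hkT => ?_
    have hk : k ≠ 0 := Finset.ne_of_mem_erase hkT
    have h1 := clause1 k hk
    have e1 : (1 / (L : ℝ) ^ d) ^ 2 * (∫ ω, wt ω * spinFourierNormSq ω k ∂μ₀) / Z =
        (1 / (L : ℝ) ^ d) * (1 / (L : ℝ) ^ d * ((∫ ω, wt ω * spinFourierNormSq ω k ∂μ₀) / Z)) := by
      ring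
    have e2 : (ν : ℝ) / (4 * β) * (1 / (L : ℝ) ^ d *
        (1 / anisoDispersion K (latticeMomentum L k))) =
        (1 / (L : ℝ) ^ d) * (ν / (4 * β * anisoDispersion K (latticeMomentum L k))) := by
      ring
    rw [e1, e2]
    exact mul_le_mul_of_nonneg_left h1 (by positivity)
  calc 1 - ν / (4 * β) * ((1 / (L : ℝ) ^ d) *
        ∑ k ∈ Finset.univ.erase (0 : TorusSite d L), 1 / anisoDispersion K (latticeMomentum L k))
      ≤ 1 - ∑ k ∈ Finset.univ.erase (0 : TorusSite d L),
          (1 / (L : ℝ) ^ d) ^ 2 * (∫ ω, wt ω * spinFourierNormSq ω k ∂μ₀) / Z := by linarith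
    _ = (∫ ω, wt ω * magnetisationNormSq ω ∂μ₀) / Z := by
        rw [hmag, sub_div, div_self hZpos.ne', Finset.mul_sum, Finset.sum_div]
    _ = ∫ ω, magnetisationNormSq ω ∂(anisoGibbs (d := d) (L := L) ρ β K) :=
        (integral_anisoGibbs ρ hρ hβ.le hKn _).symm

/-! ### Consistency with the isotropic model: `K ≡ 1` -/

/-- For the constant coupling `K ≡ 1` the anisotropic dispersion is the tree's `dispersion`.
[cite: FriedliVelenik2017, §10.5.3, proof of Thm. 10.24] -/
theorem anisoDispersion_one (p : Fin d → ℝ) : anisoDispersion (fun _ : Fin d => (1 : ℝ)) p = dispersion p := by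
  unfold anisoDispersion dispersion
  exact Finset.sum_congr rfl fun i _ => one_mul _

/-- For `K ≡ 1` the direction-weighted Hamiltonian is Friedli–Velenik's (10.38). [cite: FriedliVelenik2017, §10.5.1 eq. (10.38)] -/
theorem anisoHamiltonian_one (β : ℝ) (ω : VecConfig d L ν) :
    anisoHamiltonian β (fun _ : Fin d => (1 : ℝ)) ω = nVectorHamiltonian β ω := by
  unfold anisoHamiltonian nVectorHamiltonian
  simp only [one_mul]

/-- For `K ≡ 1` the partition function is the isotropic one. [cite: FriedliVelenik2017, §10.5.1] -/
theorem anisoPartitionFunction_one (ρ : Measure (Fin ν → ℝ)) (β : ℝ) :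
    anisoPartitionFunction (d := d) (L := L) ρ β (fun _ : Fin d => (1 : ℝ)) =
      nVectorPartitionFunction (d := d) (L := L) ρ β := by
  unfold anisoPartitionFunction nVectorPartitionFunction
  simp_rw [anisoHamiltonian_one]

/-- **For `K ≡ 1` the Gibbs measure is the isotropic `nVectorGibbs`**, so `aniso_infraredBound` /
`aniso_longRangeOrderBound` at `K ≡ 1` are exactly the two clauses of the tree's
`FriedliVelenik2017_nVector_infraredBound` (with `anisoDispersion_one`). [cite: FriedliVelenik2017, §10.5.1 and Thm. 10.24] -/
theorem anisoGibbs_one (ρ : Measure (Fin ν → ℝ)) (β : ℝ) :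
    anisoGibbs (d := d) (L := L) ρ β (fun _ : Fin d => (1 : ℝ)) = nVectorGibbs (d := d) (L := L) ρ β := by
  unfold anisoGibbs nVectorGibbs
  simp_rw [anisoPartitionFunction_one, anisoHamiltonian_one]

end TorusModel

end NVectorAniso

end Literature.Probability.LatticeModels
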